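import Literature.Probability.FitznerVanDerHofstad2017.NobleIdentity
import Literature.Barriers.CriticalPhenomena.LaceExpansionPcLimit
import Literature.Probability.Percolation.LatticeFourierProducts
import Literature.Barriers.CriticalPhenomena.GaussianDominationRouteLatticeConv
import Literature.Barriers.CriticalPhenomena.LaceExpansionIsingDeconvolutionParts
import Literature.Barriers.CriticalPhenomena.LaceExpansionPcSubcritOfBounds
import HarnessLib

/-!
# Fitzner–van der Hofstad [NoBLE17] §1.3 / §4.1.2, Lemma 3.1 and App. D (D.5) for percolation:
# the `k`-space rewrite `Ĝ_p(k) (1 − F̂_p(k)) = Φ̂_p(k)` of the NoBLE equation, KERNEL-PROVED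

Everything in this module is a THEOREM (no named facts, no `sorry`).  It removes the `k`-space rewrite of
[NoBLE17] §1.3/§4.1.2, Lemma 3.1 and the (D.5)-bounds from the hybrid, uncited leaf
`FitznerVanDerHofstad2016NoBLE_prop45ii` (`NobleAssumptions.lean`): the main theorem
`nobleSimplifiedFormAt_of_assumptions` concludes `NobleSimplifiedFormAt d p (nobleBetaOfInputs d i)` — the
conclusion of that leaf — from Assumptions 4.1/4.3 at `p`, the `x`-space NoBLE equations, two numerical side
conditions on the constants `i`, and (as explicit hypotheses) the conclusions of App. D Steps 1, 2 and 5 for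
candidate constants `c_Φ, α_Φ, c_F, α_F`.  What remains unproved of the leaf is therefore exactly App. D Step 1
((D.1)–(D.4): the constants (4.17)–(4.19) and their bounds), Step 2 ((D.13)–(D.14)) and Step 5 ((D.32)).

## Contents

* **A.** Convolution iterates `t_{n+1} = A • t_n` of a matrix of `ℓ¹` kernels on `ℤ^d`, their geometric `ℓ¹`
  decay (`kiter_l1`) and the Neumann series `s = Σ_n (−1)^n t_n` with its `k`-space equation
  `ŝ_ι + Σ_κ Â^{ι,κ} ŝ_κ = û_ι` (`kseries_neumann`) — the matrix-free form of §4.1.2 ("we use the Neumann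
  series to rewrite `F̂` and `Φ̂` into a form without matrices").
* **B.** Linear algebra of the `2d × 2d` system (1.31): the solution of
  `E_ι s_ι + μ s_{−ι} + Σ_κ Π^{ι,κ} s_κ = c_ι` from the Neumann equation with the kernel
  `A^{ι,κ} = (1−μ²)⁻¹ (E_{−ι}… )` (`vec_solve`), and UNIQUENESS by contraction (`vec_eq_zero_of_contraction`) — no
  matrix inverses are formed.
* **C.** The percolation objects: `nobleKer` (the kernel `(1−μ_p²)⁻¹(Π^{ι,κ}_p(x+e_ι) − μ_p Π^{−ι,κ}_p(x))`),
  the seeds `nobleSeedU`, `nobleSeedW`, the series `nobleS`, `nobleSW`, and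
  `F_p(x) = μ_p Σ_ι (s_ι + Ψ^ι ⋆ s_ι)(x)`, `Φ_p(x) = δ_{0,x} + Ξ_p(x) − μ_p Σ_ι (s^Ξ_ι + Ψ^ι ⋆ s^Ξ_ι)(x)`
  (§1.3 (1.32)–(1.33) with `(D̂[k] + μ_z J + Π̂_z(k))⁻¹` expanded), under the `ℓ¹` hypotheses `NobleL1At`
  (`Σ_κ‖Π^{ι,κ}‖₁ ≤ P < 1 − μ_p`, `‖Ξ^ι‖₁ ≤ X`).
* **D.–E.** The Fourier side: from the `x`-space NoBLE equations (`PercolationNobleEquationAt`, (1.24)–(1.25))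
  the vector identity (1.31) and **`Ĝ_p(k)(1 − F̂_p(k)) = Φ̂_p(k)` for all `k`** (`noble_kspace_identity`,
  complex transform `latticeFT`).
* **F.** The real form `τ̂_p(k)(1 − cosFT F_p(k)) = cosFT Φ_p(k)` (`noble_real_identity`), the values at `k = 0`
  (`noble_sums_at_zero`: `F̂_p(0) = 2dμ_p(1+ψ_p)/(1+μ_p+π_p)` etc.) and **Lemma 3.1 with the signs**
  (`noble_lemma31`: `μ_p = (1+π_p)λ/(1+ψ_p(1+λ))`, `F̂_p(0) = 2dλ/(1+λ)`, `0 ≤ λ`, `(2d−1)λ < 1`,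
  `Φ̂_p(0) > 0`, `F̂_p(0) < 1`), the signs coming from `1 + ψ_p > 0` and `‖Ξ‖₁ + ‖Ξ^ι‖₁ < 1` via the identity
  `(χ_p − ξ^ι_p)(1 − F̂_p(0)) = 1 + Ξ̂_p(0) − ξ^ι_p`.
* **G.** The split `f̂ = c + αD̂ + R̂` ((1.8)) as the `x`-space remainder `nobleRem f c α` and the assembly
  `nobleSimplifiedFormAt_of_bounds`.
* **H.** Discharge from the typed assumptions: the `ℓ¹` data from Assumption 4.3 (`nobleL1At_of_assumption43`,
  `P = (2d−1)μ̄β^abs_{Ξ^ι}` by the `κ`-summed relation, `P < 1 − μ` = (4.34)), the symmetry constants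
  `ψ_p, π_p, ξ^ι_p` from (4.28) (`noble_tsum_psi_eq`, `noble_pi_rowcol`, `noble_tsum_xiIota_eq`), the
  (D.5)-bounds `ψ_p ≥ −β_Ψ`, `π_p ≤ β_π` (`noble_psi_lower`, `noble_pi_upper`, hybrid factors as in
  `nobleBetaOfInputs`, HOME/DIVERGENCE.md D29/D43), (V) = (4.30), and the main theorem.

## Reading / divergences (HOME/DIVERGENCE.md)

* The print's `F̂_z`, `Φ̂_z` ((1.32)–(1.33)) are `k`-space expressions with a matrix inverse; here `F_p`, `Φ_p`
  are the `x`-space `ℓ¹` functions whose transforms they are (§4.1.2 (4.9)–(4.14)), the inverse being the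
  Neumann series, justified by `‖A‖ ≤ P/(1−μ_p) < 1` ((4.34), App. D (D.6)–(D.8)).  `Ĝ_p = τ̂_p` is real
  (`τ_p` even), so the real part of the complex identity is the displayed one.
* Lemma 3.1's `λ_z ≥ 0`, `(2d−1)λ_z < 1`: the print argues from `Φ̂_z(0) > 0` and `Ĝ_z(0)(1 − F̂_z(0)) = Φ̂_z(0)`
  (Assumption 2.7: "Further, we assume … c_Φ − β_{α,Φ} − β_{R,Φ} > 0").  Here the two NUMERICAL side conditions
  `β^abs_Ξ + β^abs_{Ξ^ι} < 1` and `β_Ψ < 1` on the constants `i` are used instead (they give `Φ̂_p(0) > 0`,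
  `F̂_p(0) < 1`, `1 + ψ_p > 0` directly); they are checked numerically by the user of the theorem.
* The constants `c_F, α_F, c_Φ, α_Φ` ((4.17)–(4.19)) are NOT defined here: the main theorem is stated for
  arbitrary candidates obeying the App. D Step 1/2/5 conclusions, which is all `NobleSimplifiedFormAt` asks.

[cite: FitznerVanDerHofstad2016NoBLE, §1.3 (1.27)–(1.34) (pp. 1049–1050); Lemma 3.1 (p. 1064) and its proof (pp. 1064–1066); §4.1.2 (4.8)–(4.14) (pp. 1081–1083); Assumption 4.1 (4.28) (p. 1085); (4.29)–(4.34) (pp. 1086–1087); Prop. 4.5(ii) (p. 1088); App. D (D.1)–(D.14) (pp. 1110–1118)]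
[cite: FitznerVanDerHofstad2017, Prop. 2.1 (2.14)–(2.18); §3.3, §3.5 (EJP 22 (2017) no. 43)]
-/

noncomputable section

namespace Literature.Probability.FitznerVanDerHofstad2017

open _root_.MeasureTheory _root_.Filter _root_.Topology Literature.Probability.LatticeModels
  Literature.Probability.Percolation Literature.Barriers.CriticalPhenomena
open scoped BigOperators

variable {d : ℕ}

/-! ## A. Convolution iterates of a matrix kernel on `ℤ^d` and their Neumann series -/

section Kernel

variable {I : Type*} [Fintype I]

/-- `(f ⋆ g)(x) = Σ_y f(y) g(x − y)`, the convolution on `ℤ^d`. [folklore] -/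
def lconv (f g : Site d → ℝ) (x : Site d) : ℝ := ∑' y, f y * g (x - y)

/-- `(A • t)_ι = Σ_κ A^{ι,κ} ⋆ t_κ`: a matrix of kernels applied to a vector of functions.
[cite: FitznerVanDerHofstad2016NoBLE, §4.1.2 (4.10) (the products over `s = 1,…,n`)] -/
def kapply (A : I → I → Site d → ℝ) (t : I → Site d → ℝ) : I → Site d → ℝ :=
  fun ι x => ∑ κ, lconv (A ι κ) (t κ) x

/-- The iterates `t_0 = u`, `t_{n+1} = A • t_n` (the `n`-fold products of (4.10)).
[cite: FitznerVanDerHofstad2016NoBLE, §4.1.2 (4.9)–(4.10)] -/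
def kiter (A : I → I → Site d → ℝ) (u : I → Site d → ℝ) : ℕ → I → Site d → ℝ
  | 0 => u
  | n + 1 => kapply A (kiter A u n)

/-- The Neumann series `s_ι(x) = Σ_n (−1)^n (t_n)_ι(x)` ("we use the Neumann-series to rewrite `F̂` and
`Φ̂` into a form without matrices"). [cite: FitznerVanDerHofstad2016NoBLE, §4.1.2 (display before (4.9))] -/
def kseries (A : I → I → Site d → ℝ) (u : I → Site d → ℝ) (ι : I) (x : Site d) : ℝ :=
  ∑' n, (-1 : ℝ) ^ n * kiter A u n ι x

/-- Unfolding lemma. [folklore] -/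
theorem kiter_zero (A : I → I → Site d → ℝ) (u : I → Site d → ℝ) : kiter A u 0 = u := rfl

/-- Unfolding lemma. [folklore] -/
theorem kiter_succ (A : I → I → Site d → ℝ) (u : I → Site d → ℝ) (n : ℕ) :
    kiter A u (n + 1) = kapply A (kiter A u n) := rfl

/-! ### `ℓ¹` estimates -/

/-- `f ⋆ g ∈ ℓ¹` for `f, g ∈ ℓ¹`. [folklore] -/
theorem summable_abs_lconv {f g : Site d → ℝ} (hf : Summable fun x => |f x|) (hg : Summable fun x => |g x|) :
    Summable fun x => |lconv f g x| :=
  summable_abs_tsum_mul_sub hf hg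

/-- `Σ_x |(f ⋆ g)(x)| ≤ (Σ|f|)(Σ|g|)`. [folklore] -/
theorem tsum_abs_lconv_le {f g : Site d → ℝ} (hf : Summable fun x => |f x|) (hg : Summable fun x => |g x|) :
    ∑' x, |lconv f g x| ≤ (∑' y, |f y|) * ∑' y, |g y| :=
  tsum_abs_conv_le (summable_abs_iff.1 hf) (summable_abs_iff.1 hg)

/-- `(f ⋆ g)^ = f̂ ĝ`. [folklore] -/
theorem latticeFT_lconv {f g : Site d → ℝ} (hf : Summable fun x => |f x|) (hg : Summable fun x => |g x|)
    (k : Fin d → ℝ) : latticeFT (lconv f g) k = latticeFT f k * latticeFT g k :=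
  latticeFT_tsum_mul_sub hf hg k

variable {A : I → I → Site d → ℝ} {t u : I → Site d → ℝ}

/-- `A • t ∈ ℓ¹` componentwise. [folklore] -/
theorem summable_abs_kapply (hA : ∀ ι κ, Summable fun x => |A ι κ x|) (ht : ∀ κ, Summable fun x => |t κ x|)
    (ι : I) : Summable fun x => |kapply A t ι x| := by
  refine Summable.of_nonneg_of_le (fun _ => abs_nonneg _) (fun x => Finset.abs_sum_le_sum_abs _ _)
    (summable_sum fun κ _ => summable_abs_lconv (hA ι κ) (ht κ))

/-- `‖(A • t)_ι‖₁ ≤ (Σ_κ ‖A^{ι,κ}‖₁) · max_κ ‖t_κ‖₁`. [folklore] -/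
theorem tsum_abs_kapply_le (hA : ∀ ι κ, Summable fun x => |A ι κ x|) (ht : ∀ κ, Summable fun x => |t κ x|)
    {T : ℝ} (hT : ∀ κ, ∑' x, |t κ x| ≤ T) (ι : I) :
    ∑' x, |kapply A t ι x| ≤ (∑ κ, ∑' x, |A ι κ x|) * T := by
  have h1 : ∑' x, |kapply A t ι x| ≤ ∑' x, ∑ κ, |lconv (A ι κ) (t κ) x| :=
    Summable.tsum_le_tsum (fun x => Finset.abs_sum_le_sum_abs _ _) (summable_abs_kapply hA ht ι)
      (summable_sum fun κ _ => summable_abs_lconv (hA ι κ) (ht κ))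
  refine h1.trans ?_
  rw [Summable.tsum_finsetSum (fun κ _ => summable_abs_lconv (hA ι κ) (ht κ)), Finset.sum_mul]
  refine Finset.sum_le_sum fun κ _ => (tsum_abs_lconv_le (hA ι κ) (ht κ)).trans ?_
  exact mul_le_mul_of_nonneg_left (hT κ) (tsum_nonneg fun _ => abs_nonneg _)

/-- `((A • t)_ι)^(k) = Σ_κ Â^{ι,κ}(k) t̂_κ(k)`. [folklore] -/
theorem latticeFT_kapply (hA : ∀ ι κ, Summable fun x => |A ι κ x|) (ht : ∀ κ, Summable fun x => |t κ x|)
    (ι : I) (k : Fin d → ℝ) :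
    latticeFT (kapply A t ι) k = ∑ κ, latticeFT (A ι κ) k * latticeFT (t κ) k := by
  unfold kapply
  rw [latticeFT_finset_sum _ (fun κ _ => summable_abs_lconv (hA ι κ) (ht κ))]
  exact Finset.sum_congr rfl fun κ _ => latticeFT_lconv (hA ι κ) (ht κ) k

/-- The iterates stay in `ℓ¹` and decay geometrically: `‖(t_n)_ι‖₁ ≤ θ^n U` when every row of `A` has
`ℓ¹`-mass `Σ_κ ‖A^{ι,κ}‖₁ ≤ θ` and `‖u_ι‖₁ ≤ U` (the ratio `2dμ̄β^abs_{Ξ^ι}/(1−μ)` of App. D (D.6)–(D.8)).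
[cite: FitznerVanDerHofstad2016NoBLE, App. D (D.6)–(D.8) (pp. 1111–1112)] -/
theorem kiter_l1 (hA : ∀ ι κ, Summable fun x => |A ι κ x|) (hu : ∀ ι, Summable fun x => |u ι x|)
    {θ U : ℝ} (hθ : ∀ ι, ∑ κ, ∑' x, |A ι κ x| ≤ θ) (hU : ∀ ι, ∑' x, |u ι x| ≤ U) :
    ∀ n ι, (Summable fun x => |kiter A u n ι x|) ∧ ∑' x, |kiter A u n ι x| ≤ θ ^ n * U := by
  intro n
  induction n with
  | zero => intro ι; exact ⟨hu ι, by rw [pow_zero, one_mul]; exact hU ι⟩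
  | succ n ih =>
    intro ι
    have hs : ∀ κ, Summable fun x => |kiter A u n κ x| := fun κ => (ih κ).1
    refine ⟨summable_abs_kapply hA hs ι, ?_⟩
    have hU0 : 0 ≤ θ ^ n * U := le_trans (tsum_nonneg fun _ => abs_nonneg _) (ih ι).2
    calc ∑' x, |kiter A u (n + 1) ι x| = ∑' x, |kapply A (kiter A u n) ι x| := rfl
      _ ≤ (∑ κ, ∑' x, |A ι κ x|) * (θ ^ n * U) := tsum_abs_kapply_le hA hs (fun κ => (ih κ).2) ι
      _ ≤ θ * (θ ^ n * U) := mul_le_mul_of_nonneg_right (hθ ι) hU0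
      _ = θ ^ (n + 1) * U := by ring

/-- A single value is bounded by the `ℓ¹`-mass: `|(t_n)_ι(x)| ≤ θ^n U`. [folklore] -/
theorem abs_kiter_le (hA : ∀ ι κ, Summable fun x => |A ι κ x|) (hu : ∀ ι, Summable fun x => |u ι x|)
    {θ U : ℝ} (hθ : ∀ ι, ∑ κ, ∑' x, |A ι κ x| ≤ θ) (hU : ∀ ι, ∑' x, |u ι x| ≤ U)
    (n : ℕ) (ι : I) (x : Site d) : |kiter A u n ι x| ≤ θ ^ n * U := by
  obtain ⟨hs, hle⟩ := kiter_l1 hA hu hθ hU n ι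
  exact (hs.le_tsum x fun y _ => abs_nonneg _).trans hle

/-- Under `θ < 1`: `Σ_n |(t_n)_ι(x)|` converges for every `x`, `x ↦ Σ_n |(t_n)_ι(x)|` is summable, and
`Σ_x Σ_n |(t_n)_ι(x)| ≤ U/(1−θ)`. [cite: FitznerVanDerHofstad2016NoBLE, App. D (D.8) (the geometric sum)] -/
theorem kiter_series_l1 (hA : ∀ ι κ, Summable fun x => |A ι κ x|) (hu : ∀ ι, Summable fun x => |u ι x|)
    {θ U : ℝ} (hθ0 : 0 ≤ θ) (hθ1 : θ < 1) (hθ : ∀ ι, ∑ κ, ∑' x, |A ι κ x| ≤ θ)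
    (hU : ∀ ι, ∑' x, |u ι x| ≤ U) (ι : I) :
    (∀ x, Summable fun n => |kiter A u n ι x|) ∧ (Summable fun x => ∑' n, |kiter A u n ι x|) ∧
      (Summable fun n => ∑' x, |kiter A u n ι x|) ∧ ∑' x, ∑' n, |kiter A u n ι x| ≤ U / (1 - θ) := by
  have hgeo : Summable fun n : ℕ => θ ^ n * U := (summable_geometric_of_lt_one hθ0 hθ1).mul_right U
  have hN : Summable fun n => ∑' x, |kiter A u n ι x| :=
    Summable.of_nonneg_of_le (fun n => tsum_nonneg fun _ => abs_nonneg _)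
      (fun n => (kiter_l1 hA hu hθ hU n ι).2) hgeo
  obtain ⟨h1, h2⟩ := summable_swap_of_nonneg (F := fun n x => |kiter A u n ι x|) (fun _ _ => abs_nonneg _)
    (fun n => (kiter_l1 hA hu hθ hU n ι).1) hN
  refine ⟨h1, h2, hN, ?_⟩
  have hprod : Summable (fun q : ℕ × Site d => |kiter A u q.1 ι q.2|) :=
    (summable_prod_of_nonneg (fun q => abs_nonneg _)).2 ⟨fun n => (kiter_l1 hA hu hθ hU n ι).1, hN⟩
  have hcomm : ∑' x, ∑' n, |kiter A u n ι x| = ∑' n, ∑' x, |kiter A u n ι x| :=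
    Summable.tsum_comm (f := fun n x => |kiter A u n ι x|) hprod
  rw [hcomm]
  calc ∑' n, ∑' x, |kiter A u n ι x| ≤ ∑' n : ℕ, θ ^ n * U :=
        Summable.tsum_le_tsum (fun n => (kiter_l1 hA hu hθ hU n ι).2) hN hgeo
    _ = U / (1 - θ) := by rw [tsum_mul_right, tsum_geometric_of_lt_one hθ0 hθ1]; field_simp

/-- `|Σ_n (−1)^n a_n| ≤ Σ_n |a_n|` for absolutely summable `a`. [folklore] -/
theorem abs_tsum_negOnePow_mul_le {a : ℕ → ℝ} (ha : Summable fun n => |a n|) :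
    |∑' n, (-1 : ℝ) ^ n * a n| ≤ ∑' n, |a n| := by
  have h : ∀ n, ‖(-1 : ℝ) ^ n * a n‖ = |a n| := fun n => by
    rw [norm_mul, norm_pow, norm_neg, norm_one, one_pow, one_mul, Real.norm_eq_abs]
  rw [← Real.norm_eq_abs]
  exact (norm_tsum_le_tsum_norm (by simpa only [h] using ha)).trans (le_of_eq (tsum_congr h))

/-- `n ↦ (−1)^n a_n` is summable for absolutely summable `a`. [folklore] -/
theorem summable_negOnePow_mul {a : ℕ → ℝ} (ha : Summable fun n => |a n|) :
    Summable fun n => (-1 : ℝ) ^ n * a n :=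
  Summable.of_norm_bounded ha fun n => by
    rw [norm_mul, norm_pow, norm_neg, norm_one, one_pow, one_mul, Real.norm_eq_abs]

/-- The Neumann series is termwise absolutely convergent and `s_ι ∈ ℓ¹` with `‖s_ι‖₁ ≤ U/(1−θ)`.
[cite: FitznerVanDerHofstad2016NoBLE, App. D (D.8)] -/
theorem kseries_l1 (hA : ∀ ι κ, Summable fun x => |A ι κ x|) (hu : ∀ ι, Summable fun x => |u ι x|)
    {θ U : ℝ} (hθ0 : 0 ≤ θ) (hθ1 : θ < 1) (hθ : ∀ ι, ∑ κ, ∑' x, |A ι κ x| ≤ θ)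
    (hU : ∀ ι, ∑' x, |u ι x| ≤ U) (ι : I) :
    (Summable fun x => |kseries A u ι x|) ∧ ∑' x, |kseries A u ι x| ≤ U / (1 - θ) := by
  obtain ⟨h1, h2, -, h4⟩ := kiter_series_l1 hA hu hθ0 hθ1 hθ hU ι
  have hpt : ∀ x, |kseries A u ι x| ≤ ∑' n, |kiter A u n ι x| := fun x =>
    abs_tsum_negOnePow_mul_le (h1 x)
  have hs : Summable fun x => |kseries A u ι x| :=
    Summable.of_nonneg_of_le (fun _ => abs_nonneg _) hpt h2
  exact ⟨hs, (Summable.tsum_le_tsum hpt hs h2).trans h4⟩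

/-! ### The Fourier side of the Neumann series -/

/-- `|t̂_{n,ι}(k)| ≤ θ^n U`. [folklore] -/
theorem norm_latticeFT_kiter_le (hA : ∀ ι κ, Summable fun x => |A ι κ x|)
    (hu : ∀ ι, Summable fun x => |u ι x|) {θ U : ℝ} (hθ : ∀ ι, ∑ κ, ∑' x, |A ι κ x| ≤ θ)
    (hU : ∀ ι, ∑' x, |u ι x| ≤ U) (n : ℕ) (ι : I) (k : Fin d → ℝ) :
    ‖latticeFT (kiter A u n ι) k‖ ≤ θ ^ n * U :=
  (norm_latticeFT_le (kiter_l1 hA hu hθ hU n ι).1 k).trans (kiter_l1 hA hu hθ hU n ι).2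

/-- The signed transforms `n ↦ (−1)^n t̂_{n,ι}(k)` are absolutely summable (`θ < 1`). [folklore] -/
theorem summable_negOnePow_latticeFT_kiter (hA : ∀ ι κ, Summable fun x => |A ι κ x|)
    (hu : ∀ ι, Summable fun x => |u ι x|) {θ U : ℝ} (hθ0 : 0 ≤ θ) (hθ1 : θ < 1)
    (hθ : ∀ ι, ∑ κ, ∑' x, |A ι κ x| ≤ θ) (hU : ∀ ι, ∑' x, |u ι x| ≤ U) (ι : I) (k : Fin d → ℝ) :
    Summable fun n => (-1 : ℂ) ^ n * latticeFT (kiter A u n ι) k := by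
  refine Summable.of_norm_bounded ((summable_geometric_of_lt_one hθ0 hθ1).mul_right U) fun n => ?_
  rw [norm_mul, norm_pow, norm_neg, norm_one, one_pow, one_mul]
  exact norm_latticeFT_kiter_le hA hu hθ hU n ι k

/-- **Termwise transform of the Neumann series**: `ŝ_ι(k) = Σ_n (−1)^n t̂_{n,ι}(k)` (exchange of the
`x`- and `n`-sums, absolutely convergent double series). [cite: FitznerVanDerHofstad2016NoBLE, §4.1.2 ("The Fourier inverse of F̂_n … is given by" (4.9)–(4.10))] -/
theorem latticeFT_kseries (hA : ∀ ι κ, Summable fun x => |A ι κ x|)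
    (hu : ∀ ι, Summable fun x => |u ι x|) {θ U : ℝ} (hθ0 : 0 ≤ θ) (hθ1 : θ < 1)
    (hθ : ∀ ι, ∑ κ, ∑' x, |A ι κ x| ≤ θ) (hU : ∀ ι, ∑' x, |u ι x| ≤ U) (ι : I) (k : Fin d → ℝ) :
    latticeFT (kseries A u ι) k = ∑' n, (-1 : ℂ) ^ n * latticeFT (kiter A u n ι) k := by
  obtain ⟨h1, -, hN, -⟩ := kiter_series_l1 hA hu hθ0 hθ1 hθ hU ι
  set E : Site d → ℂ := fun x => Complex.exp (-(Complex.I * (kdot k x : ℂ))) with hE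
  have hEn : ∀ x, ‖E x‖ = 1 := fun x => by
    rw [hE]; simp only [Complex.norm_exp, Complex.neg_re, Complex.mul_re, Complex.I_re,
      Complex.ofReal_re, zero_mul, Complex.I_im, Complex.ofReal_im, mul_zero, sub_zero, neg_zero,
      Real.exp_zero]
  -- the double family
  set G : Site d → ℕ → ℂ := fun x n => (((-1 : ℝ) ^ n * kiter A u n ι x : ℝ) : ℂ) * E x with hG
  have hGn : ∀ x n, ‖G x n‖ = |kiter A u n ι x| := fun x n => by
    rw [hG]; simp only [norm_mul, Complex.norm_real, hEn, mul_one, Real.norm_eq_abs, abs_pow,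
      abs_neg, abs_one, one_pow, one_mul]
  have hprod : Summable (fun q : ℕ × Site d => |kiter A u q.1 ι q.2|) :=
    (summable_prod_of_nonneg (fun q => abs_nonneg _)).2 ⟨fun n => (kiter_l1 hA hu hθ hU n ι).1, hN⟩
  have hGs : Summable (Function.uncurry G) := by
    refine Summable.of_norm ?_
    have : Summable (fun q : Site d × ℕ => |kiter A u q.2 ι q.1|) := hprod.prod_symm
    exact this.congr fun q => (hGn q.1 q.2).symm
  -- left-hand side as a double sum
  have hL : latticeFT (kseries A u ι) k = ∑' x, ∑' n, G x n := by
    unfold latticeFT kseries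
    refine tsum_congr fun x => ?_
    rw [Complex.ofReal_tsum, ← tsum_mul_right]
  rw [hL, ← Summable.tsum_comm hGs]
  refine tsum_congr fun n => ?_
  show ∑' x, G x n = _
  unfold latticeFT
  rw [← tsum_mul_left]
  refine tsum_congr fun x => ?_
  rw [hG]; push_cast; ring

/-- **The Neumann identity in `k`-space**: `ŝ_ι(k) + Σ_κ Â^{ι,κ}(k) ŝ_κ(k) = û_ι(k)`, i.e.
`(I + Â(k)) ŝ(k) = û(k)` — the resummation `Σ_n (−1)^n Âⁿ (I + Â) = I` done termwise.
[cite: FitznerVanDerHofstad2016NoBLE, §4.1.2 (the Neumann series for `[I + (1−μ²)⁻¹(D(−k) − μJ)Π̂(k)]⁻¹`)] -/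
theorem kseries_neumann (hA : ∀ ι κ, Summable fun x => |A ι κ x|)
    (hu : ∀ ι, Summable fun x => |u ι x|) {θ U : ℝ} (hθ0 : 0 ≤ θ) (hθ1 : θ < 1)
    (hθ : ∀ ι, ∑ κ, ∑' x, |A ι κ x| ≤ θ) (hU : ∀ ι, ∑' x, |u ι x| ≤ U) (ι : I) (k : Fin d → ℝ) :
    latticeFT (kseries A u ι) k + ∑ κ, latticeFT (A ι κ) k * latticeFT (kseries A u κ) k =
      latticeFT (u ι) k := by
  have hs : ∀ κ, Summable fun n => (-1 : ℂ) ^ n * latticeFT (kiter A u n κ) k :=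
    fun κ => summable_negOnePow_latticeFT_kiter hA hu hθ0 hθ1 hθ hU κ k
  set a : ℕ → ℂ := fun n => (-1 : ℂ) ^ n * latticeFT (kiter A u n ι) k with ha
  have hsa : Summable a := hs ι
  -- `Σ_κ Â^{ι,κ} ŝ_κ = Σ_n (−1)^n t̂_{n+1,ι} = −Σ_n a(n+1)`
  have hstep : ∀ n, ∑ κ, latticeFT (A ι κ) k * ((-1 : ℂ) ^ n * latticeFT (kiter A u n κ) k) =
      -a (n + 1) := fun n => by
    rw [ha]
    simp only
    rw [kiter_succ, latticeFT_kapply hA (fun κ => (kiter_l1 hA hu hθ hU n κ).1) ι k, pow_succ,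
      Finset.mul_sum, ← Finset.sum_neg_distrib]
    exact Finset.sum_congr rfl fun κ _ => by ring
  have h2 : ∑ κ, latticeFT (A ι κ) k * latticeFT (kseries A u κ) k = -∑' n, a (n + 1) := by
    calc ∑ κ, latticeFT (A ι κ) k * latticeFT (kseries A u κ) k
        = ∑ κ, ∑' n, latticeFT (A ι κ) k * ((-1 : ℂ) ^ n * latticeFT (kiter A u n κ) k) := by
          refine Finset.sum_congr rfl fun κ _ => ?_
          rw [latticeFT_kseries hA hu hθ0 hθ1 hθ hU κ k, tsum_mul_left]
      _ = ∑' n, ∑ κ, latticeFT (A ι κ) k * ((-1 : ℂ) ^ n * latticeFT (kiter A u n κ) k) :=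
          (Summable.tsum_finsetSum fun κ _ => (hs κ).mul_left _).symm
      _ = ∑' n, -a (n + 1) := tsum_congr hstep
      _ = -∑' n, a (n + 1) := tsum_neg
  rw [h2, latticeFT_kseries hA hu hθ0 hθ1 hθ hU ι k, hsa.tsum_eq_zero_add]
  show a 0 + ∑' n, a (n + 1) + -∑' n, a (n + 1) = latticeFT (u ι) k
  rw [ha]
  simp [kiter_zero]

end Kernel

/-! ## B. Linear algebra of the `2d × 2d` system `Ĝ 1⃗ = (D + μJ + Π̂) τ⃗ + Ξ⃗` without matrices

The matrix `D_k + μ_p J` of [NoBLE17] (1.31) has the explicit two-sided inverse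
`B = (D_{-k} − μ_p J)/(1 − μ_p²)` ((1.31): `D̂_{-k} J = J D̂_k`, `JJ = I`); we never form inverses and only
use the two scalar consequences below, valid over any field. -/

section VecAlgebra

variable {ι : Type*} [Fintype ι] {K : Type*} [Field K]

/-- If `ŝ` solves the Neumann fixed-point equation `ŝ + B Π̂ ŝ = B c` (`B = (D_{-k} − μJ)/(1−μ²)`), then
`(D_k + μJ + Π̂) ŝ = c`. [cite: FitznerVanDerHofstad2016NoBLE, (1.31)–(1.33) (p. 1050)] -/
theorem vec_solve (rev : ι → ι) (hrev : ∀ i, rev (rev i) = i) {E Es : ι → K}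
    (hE : ∀ i, E i * Es i = 1) (hErev : ∀ i, Es (rev i) = E i) {μ : K} (hμ : 1 - μ ^ 2 ≠ 0)
    {Pm A : ι → ι → K} (hA : ∀ i κ, A i κ = (1 - μ ^ 2)⁻¹ * (Es i * Pm i κ - μ * Pm (rev i) κ))
    {s : ι → K} (c : ι → K)
    (hN0 : ∀ i, s i + ∑ κ, A i κ * s κ = (1 - μ ^ 2)⁻¹ * (Es i * c i - μ * c (rev i))) :
    ∀ i, E i * s i + μ * s (rev i) + ∑ κ, Pm i κ * s κ = c i := by
  have hN : ∀ i, s i + ∑ κ, ((1 - μ ^ 2)⁻¹ * (Es i * Pm i κ - μ * Pm (rev i) κ)) * s κ =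
      (1 - μ ^ 2)⁻¹ * (Es i * c i - μ * c (rev i)) := fun i => by
    have h := hN0 i
    simp only [hA] at h
    exact h
  intro i
  have expand : ∀ j, ∑ κ, ((1 - μ ^ 2)⁻¹ * (Es j * Pm j κ - μ * Pm (rev j) κ)) * s κ =
      (1 - μ ^ 2)⁻¹ * (Es j * ∑ κ, Pm j κ * s κ - μ * ∑ κ, Pm (rev j) κ * s κ) := fun j => by
    rw [Finset.mul_sum, Finset.mul_sum, ← Finset.sum_sub_distrib, Finset.mul_sum]
    exact Finset.sum_congr rfl fun κ _ => by ring
  have h1 := hN i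
  have h2 := hN (rev i)
  rw [expand] at h1 h2
  rw [hrev, hErev] at h2
  set S := fun j => ∑ κ, Pm j κ * s κ with hS
  have h1' : (1 - μ ^ 2) * s i + (Es i * S i - μ * S (rev i)) = Es i * c i - μ * c (rev i) := by
    have := congrArg (fun t => (1 - μ ^ 2) * t) h1
    simp only [mul_add, ← mul_assoc, mul_inv_cancel₀ hμ, one_mul] at this
    exact this
  have h2' : (1 - μ ^ 2) * s (rev i) + (E i * S (rev i) - μ * S i) = E i * c (rev i) - μ * c i := by
    have := congrArg (fun t => (1 - μ ^ 2) * t) h2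
    simp only [mul_add, ← mul_assoc, mul_inv_cancel₀ hμ, one_mul] at this
    exact this
  have key : (1 - μ ^ 2) * (E i * s i + μ * s (rev i) + S i - c i) = 0 := by
    linear_combination (E i) * h1' + μ * h2' + (c i - S i) * hE i
  rcases mul_eq_zero.1 key with h | h
  · exact absurd h hμ
  · exact sub_eq_zero.1 h

/-- Conversely, a solution of the homogeneous system `(D_k + μJ + Π̂) z = 0` solves `z + BΠ̂ z = 0`.
[cite: FitznerVanDerHofstad2016NoBLE, (1.31)–(1.33) (p. 1050)] -/
theorem vec_kernel (rev : ι → ι) (hrev : ∀ i, rev (rev i) = i) {E Es : ι → K}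
    (hE : ∀ i, E i * Es i = 1) (hErev : ∀ i, Es (rev i) = E i) {μ : K} (hμ : 1 - μ ^ 2 ≠ 0)
    {Pm A : ι → ι → K} (hA : ∀ i κ, A i κ = (1 - μ ^ 2)⁻¹ * (Es i * Pm i κ - μ * Pm (rev i) κ))
    {z : ι → K} (hz : ∀ i, E i * z i + μ * z (rev i) + ∑ κ, Pm i κ * z κ = 0) :
    ∀ i, z i + ∑ κ, A i κ * z κ = 0 := by
  intro i
  simp only [hA]
  have hErev' : E (rev i) = Es i := by rw [← hErev (rev i), hrev]
  have h1 := hz i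
  have h2 := hz (rev i)
  rw [hrev, hErev'] at h2
  set S := fun j => ∑ κ, Pm j κ * z κ with hS
  have expand : ∑ κ, ((1 - μ ^ 2)⁻¹ * (Es i * Pm i κ - μ * Pm (rev i) κ)) * z κ =
      (1 - μ ^ 2)⁻¹ * (Es i * S i - μ * S (rev i)) := by
    rw [hS]
    simp only
    rw [Finset.mul_sum, Finset.mul_sum, ← Finset.sum_sub_distrib, Finset.mul_sum]
    exact Finset.sum_congr rfl fun κ _ => by ring
  rw [expand]
  have key : (1 - μ ^ 2) * z i + (Es i * S i - μ * S (rev i)) = 0 := by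
    linear_combination (Es i) * h1 - μ * h2 - (z i) * hE i
  calc z i + (1 - μ ^ 2)⁻¹ * (Es i * S i - μ * S (rev i))
      = (1 - μ ^ 2)⁻¹ * ((1 - μ ^ 2) * z i + (Es i * S i - μ * S (rev i))) := by
        rw [mul_add, ← mul_assoc, inv_mul_cancel₀ hμ, one_mul]
    _ = 0 := by rw [key, mul_zero]

/-- **Max-norm contraction**: if `z = −a z` with row sums `Σ_κ |a_{iκ}| ≤ θ < 1` then `z = 0` — the
invertibility of `D_k + μJ + Π̂(k)` via the Neumann series. [cite: FitznerVanDerHofstad2016NoBLE, §4.1.2 (Neumann series, "valid … when absolutely summable")] -/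
theorem vec_eq_zero_of_contraction {a : ι → ι → ℂ} {z : ι → ℂ} {θ : ℝ} (hθ : θ < 1)
    (ha : ∀ i, ∑ κ, ‖a i κ‖ ≤ θ) (hz : ∀ i, z i + ∑ κ, a i κ * z κ = 0) : z = 0 := by
  rcases isEmpty_or_nonempty ι with hι | hι
  · exact funext fun i => isEmptyElim i
  obtain ⟨i, -, hi⟩ := Finset.exists_max_image Finset.univ (fun j => ‖z j‖) Finset.univ_nonempty
  have hzi : ‖z i‖ ≤ θ * ‖z i‖ := by
    have h := hz i
    rw [add_eq_zero_iff_eq_neg] at h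
    calc ‖z i‖ = ‖∑ κ, a i κ * z κ‖ := by rw [h, norm_neg]
      _ ≤ ∑ κ, ‖a i κ * z κ‖ := norm_sum_le _ _
      _ ≤ ∑ κ, ‖a i κ‖ * ‖z i‖ := Finset.sum_le_sum fun κ _ => by
          rw [norm_mul]; exact mul_le_mul_of_nonneg_left (hi κ (Finset.mem_univ κ)) (norm_nonneg _)
      _ = (∑ κ, ‖a i κ‖) * ‖z i‖ := (Finset.sum_mul _ _ _).symm
      _ ≤ θ * ‖z i‖ := mul_le_mul_of_nonneg_right (ha i) (norm_nonneg _)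
  have hz0 : ‖z i‖ = 0 := by
    have : (1 - θ) * ‖z i‖ ≤ 0 := by nlinarith [norm_nonneg (z i)]
    nlinarith [norm_nonneg (z i)]
  funext κ
  have : ‖z κ‖ ≤ 0 := by simpa [hz0] using hi κ (Finset.mem_univ κ)
  exact norm_le_zero_iff.1 this

end VecAlgebra

/-! ## C. The NoBLE kernel, seeds, Neumann series and the functions `F_p`, `Φ_p` for percolation -/

section Noble

local notation "𝐞" => Literature.Probability.Percolation.stepVec

/-! ### Small `ℓ¹` helpers -/

/-- [folklore] -/
theorem summable_abs_add' {f g : Site d → ℝ} (hf : Summable fun x => |f x|) (hg : Summable fun x => |g x|) :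
    Summable fun x => |f x + g x| :=
  Summable.of_nonneg_of_le (fun _ => abs_nonneg _) (fun _ => abs_add_le _ _) (hf.add hg)

/-- [folklore] -/
theorem summable_abs_sub' {f g : Site d → ℝ} (hf : Summable fun x => |f x|) (hg : Summable fun x => |g x|) :
    Summable fun x => |f x - g x| :=
  Summable.of_nonneg_of_le (fun _ => abs_nonneg _) (fun _ => abs_sub _ _) (hf.add hg)

/-- [folklore] -/
theorem summable_abs_const_mul' {f : Site d → ℝ} (c : ℝ) (hf : Summable fun x => |f x|) :
    Summable fun x => |c * f x| := by
  simpa only [abs_mul] using hf.mul_left |c|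

/-- [folklore] -/
theorem summable_abs_finset_sum' {ι : Type*} (s : Finset ι) {f : ι → Site d → ℝ}
    (hf : ∀ i ∈ s, Summable fun x => |f i x|) : Summable fun x => |∑ i ∈ s, f i x| :=
  Summable.of_nonneg_of_le (fun _ => abs_nonneg _) (fun _ => Finset.abs_sum_le_sum_abs _ _)
    (summable_sum fun i hi => hf i hi)

/-- `Σ_x |f(x + v)| = Σ_x |f x|`. [folklore] -/
theorem tsum_abs_comp_add_right (f : Site d → ℝ) (v : Site d) : ∑' x, |f (x + v)| = ∑' x, |f x| :=
  (Equiv.addRight v).tsum_eq (fun x => |f x|)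

/-- `Σ_x |c (f x − μ g x)| ≤ |c| (Σ|f| + |μ| Σ|g|)`. [folklore] -/
theorem tsum_abs_smul_sub_le {f g : Site d → ℝ} (c μ : ℝ) (hf : Summable fun x => |f x|)
    (hg : Summable fun x => |g x|) :
    ∑' x, |c * (f x - μ * g x)| ≤ |c| * ((∑' x, |f x|) + |μ| * ∑' x, |g x|) := by
  have hpt : ∀ x, |c * (f x - μ * g x)| ≤ |c| * (|f x| + |μ| * |g x|) := fun x => by
    rw [abs_mul]
    refine mul_le_mul_of_nonneg_left ((abs_sub _ _).trans (by rw [abs_mul])) (abs_nonneg _)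
  have hs : Summable fun x => |c| * (|f x| + |μ| * |g x|) := (hf.add (hg.mul_left _)).mul_left _
  refine (Summable.tsum_le_tsum hpt (summable_abs_const_mul' c (summable_abs_sub' hf
    (summable_abs_const_mul' μ hg))) hs).trans (le_of_eq ?_)
  rw [tsum_mul_left, (hf.tsum_add (hg.mul_left _)), tsum_mul_left]

/-! ### The phase `e^{ik·v}` -/

/-- `e^{ik·v}`. [folklore] -/
def ephase (k : Fin d → ℝ) (v : Site d) : ℂ := Complex.exp (Complex.I * (kdot k v : ℂ))

/-- `e^{ik·(−v)} e^{ik·v} = 1`. [folklore] -/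
theorem ephase_neg_mul (k : Fin d → ℝ) (v : Site d) : ephase k (-v) * ephase k v = 1 := by
  unfold ephase
  rw [← Complex.exp_add, kdot_neg]
  push_cast
  simp

/-- `‖e^{ik·v}‖ = 1`. [folklore] -/
theorem norm_ephase (k : Fin d → ℝ) (v : Site d) : ‖ephase k v‖ = 1 := by
  unfold ephase
  rw [Complex.norm_exp]
  simp

/-- The transform of a shift: `(f(· + v))^(k) = e^{ik·v} f̂(k)`. [folklore] -/
theorem latticeFT_shift (f : Site d → ℝ) (v : Site d) (k : Fin d → ℝ) :
    latticeFT (fun y => f (y + v)) k = ephase k v * latticeFT f k :=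
  latticeFT_comp_add_right f v k

/-! ### The objects -/

/-- `δ_{0,x}`. [folklore] -/
def nobleDelta (x : Site d) : ℝ := if x = 0 then 1 else 0

/-- `τ⃗`: the vector `b_κ(x) = τ^{κ}_p(x + e_κ)` whose transform is `e^{ik_κ} τ̂^κ_p(k)`, entry `κ` of
`D̂_{-k} G⃗(k)`. [cite: FitznerVanDerHofstad2016NoBLE, (1.24)–(1.30) (pp. 1048–1050)] -/
def nobleTauVec (d : ℕ) (p : unitInterval) (κ : Fin d × Bool) (x : Site d) : ℝ :=
  tauOff d p (𝐞 κ) (x + 𝐞 κ)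

/-- The NoBLE kernel `A^{ι,κ}_p(x) = (Π^{ι,κ}_p(x + e_ι) − μ_p Π^{−ι,κ}_p(x)) / (1 − μ_p²)`, the `x`-space
form of `(1−μ²)⁻¹ (D̂_{−k} − μJ) Π̂(k)` — the factors of (4.10).
[cite: FitznerVanDerHofstad2016NoBLE, §4.1.2 (4.10) (p. 1082)] -/
def nobleKer (d : ℕ) (p : unitInterval) (ι κ : Fin d × Bool) (x : Site d) : ℝ :=
  (1 - nobleMu d p ^ 2)⁻¹ * (noblePi d p ι κ (x + 𝐞 ι) - nobleMu d p * noblePi d p (srev ι) κ x)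

/-- The seed `u_ι(x) = (δ_{x,−e_ι} − μ_p δ_{0,x})/(1 − μ_p²)` of `F_{p,0}` (4.9).
[cite: FitznerVanDerHofstad2016NoBLE, §4.1.2 (4.9) (p. 1082)] -/
def nobleSeedU (d : ℕ) (p : unitInterval) (ι : Fin d × Bool) (x : Site d) : ℝ :=
  (1 - nobleMu d p ^ 2)⁻¹ * (nobleDelta (x + 𝐞 ι) - nobleMu d p * nobleDelta x)

/-- The seed `w_ι(x) = (Ξ^ι_p(x + e_ι) − μ_p Ξ^{−ι}_p(x))/(1 − μ_p²)` of `Φ_{p,n}` (4.14).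
[cite: FitznerVanDerHofstad2016NoBLE, §4.1.2 (4.13)–(4.14) (p. 1082)] -/
def nobleSeedW (d : ℕ) (p : unitInterval) (ι : Fin d × Bool) (x : Site d) : ℝ :=
  (1 - nobleMu d p ^ 2)⁻¹ * (nobleXiIota d p ι (x + 𝐞 ι) - nobleMu d p * nobleXiIota d p (srev ι) x)

/-- `s = Σ_n (−1)^n Aⁿ • u` (the resummed `F`-side vector). [cite: FitznerVanDerHofstad2016NoBLE, §4.1.2 (4.8)–(4.10) (p. 1082)] -/
def nobleS (d : ℕ) (p : unitInterval) : Fin d × Bool → Site d → ℝ := kseries (nobleKer d p) (nobleSeedU d p)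

/-- `s^Ξ = Σ_n (−1)^n Aⁿ • w` (the resummed `Φ`-side vector). [cite: FitznerVanDerHofstad2016NoBLE, §4.1.2 (4.12)–(4.14) (p. 1082)] -/
def nobleSW (d : ℕ) (p : unitInterval) : Fin d × Bool → Site d → ℝ := kseries (nobleKer d p) (nobleSeedW d p)

/-- **`F_p(x) = Σ_n F_{p,n}(x)`** of [NoBLE17] (4.8)–(4.10): `F_p = μ_p Σ_ι (s_ι + Ψ^ι_p ⋆ s_ι)`, whose
transform is `F̂_p(k) = μ_p 1⃗ᵀ(D̂_k + μ_p J + Π̂_p(k))⁻¹ (1⃗ + Ψ⃗_p(k))`-rearranged as in (1.34).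
[cite: FitznerVanDerHofstad2016NoBLE, (1.34) (p. 1050); §4.1.2 (4.8)–(4.10) (p. 1082)] -/
def nobleF (d : ℕ) (p : unitInterval) (x : Site d) : ℝ :=
  nobleMu d p * ∑ ι, (nobleS d p ι x + lconv (noblePsi d p ι) (nobleS d p ι) x)

/-- **`Φ_p(x) = Σ_n Φ_{p,n}(x)`** of [NoBLE17] (4.12)–(4.14): `Φ_p = δ + Ξ_p − μ_p Σ_ι (s^Ξ_ι + Ψ^ι_p ⋆ s^Ξ_ι)`.
[cite: FitznerVanDerHofstad2016NoBLE, (1.34) (p. 1050); §4.1.2 (4.12)–(4.14) (p. 1082)] -/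
def noblePhi (d : ℕ) (p : unitInterval) (x : Site d) : ℝ :=
  nobleDelta x + nobleXi d p x - nobleMu d p * ∑ ι, (nobleSW d p ι x + lconv (noblePsi d p ι) (nobleSW d p ι) x)

/-- The analytic standing hypotheses of the rewrite at one `p`: `μ_p < 1`, `τ_p ∈ ℓ¹`, the completed
coefficients `Ξ_p, Ψ^κ_p, Ξ^ι_p, Π^{ι,κ}_p ∈ ℓ¹(ℤ^d)` with `Σ_x|Ξ^ι_p| ≤ X` and row sums
`Σ_κ Σ_x |Π^{ι,κ}_p(x)| ≤ P < 1 − μ_p` (which makes the Neumann series absolutely convergent, ratio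
`P/(1−μ_p) < 1`, cf. (D.6)–(D.8)).  A bundle of hypotheses, NOT a cited fact: it is discharged from
[NoBLE17] Assumptions 4.2/4.3 for percolation by `nobleL1At_of_assumptions` below.
[cite: FitznerVanDerHofstad2016NoBLE, §4.1.2 ("we assume that these sums converge, which we verify explicitly in the relevant examples"), App. D (D.6)–(D.8) (pp. 1082, 1111–1112)] -/
structure NobleL1At (d : ℕ) (p : unitInterval) (P X : ℝ) : Prop where
  mu_lt_one : nobleMu d p < 1
  tau : Summable fun x => tau d p 0 x
  xi : Summable fun x => |nobleXi d p x|
  psi : ∀ κ, Summable fun x => |noblePsi d p κ x|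
  xiIota : ∀ ι, Summable fun x => |nobleXiIota d p ι x|
  pi : ∀ ι κ, Summable fun x => |noblePi d p ι κ x|
  xiIota_le : ∀ ι, ∑' x, |nobleXiIota d p ι x| ≤ X
  pi_le : ∀ ι, ∑ κ, ∑' x, |noblePi d p ι κ x| ≤ P
  P_lt : P < 1 - nobleMu d p

variable {p : unitInterval} {P X : ℝ}

/-! ### `ℓ¹` facts -/

/-- Auxiliary estimate / unfolding. [folklore] -/
theorem abs_nobleDelta (x : Site d) : |nobleDelta x| = nobleDelta x := by
  unfold nobleDelta; split_ifs <;> simp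

/-- [folklore] -/
theorem summable_nobleDelta : Summable (nobleDelta : Site d → ℝ) := by
  refine summable_of_ne_finset_zero (s := {0}) fun x hx => ?_
  simp only [Finset.mem_singleton] at hx
  simp [nobleDelta, hx]

/-- [folklore] -/
theorem summable_abs_nobleDelta : Summable fun x : Site d => |nobleDelta x| := by
  simpa only [abs_nobleDelta] using (summable_nobleDelta (d := d))

/-- [folklore] -/
theorem tsum_nobleDelta : ∑' x : Site d, nobleDelta x = 1 := by
  unfold nobleDelta
  rw [tsum_ite_eq]

/-- `nobleDelta` is the tree's `SpreadOutIsing.delta0` (kept under its own name to avoid opening that namespace). [folklore] -/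
theorem nobleDelta_eq_delta0 : (nobleDelta : Site d → ℝ) = SpreadOutIsing.delta0 := rfl

/-- `b_κ ∈ ℓ¹` below `p_c`. [folklore] -/
theorem summable_abs_nobleTauVec (hτ : Summable fun x => tau d p 0 x) (κ : Fin d × Bool) :
    Summable fun x => |nobleTauVec d p κ x| := by
  refine Summable.of_nonneg_of_le (fun _ => abs_nonneg _) (fun x => ?_)
    ((Equiv.addRight (𝐞 κ)).summable_iff.2 hτ)
  show |tauOff d p (𝐞 κ) (x + 𝐞 κ)| ≤ tau d p 0 (x + 𝐞 κ)
  rw [abs_of_nonneg (tauOff_nonneg p _ _)]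
  exact tauOff_le_tau p _ _

/-- Auxiliary estimate / unfolding. [folklore] -/
theorem abs_nobleTauVec_le_one (κ : Fin d × Bool) (x : Site d) : |nobleTauVec d p κ x| ≤ 1 := by
  unfold nobleTauVec
  rw [abs_of_nonneg (tauOff_nonneg p _ _)]
  exact tauOff_le_one p _ _

/-- Auxiliary estimate / unfolding. [folklore] -/
theorem one_sub_mu_sq_pos (h : NobleL1At d p P X) : 0 < 1 - nobleMu d p ^ 2 := by
  have h0 := nobleMu_nonneg d p
  have h1 := h.mu_lt_one
  nlinarith

/-- `A^{ι,κ} ∈ ℓ¹`. [folklore] -/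
theorem summable_abs_nobleKer (h : NobleL1At d p P X) (ι κ : Fin d × Bool) :
    Summable fun x => |nobleKer d p ι κ x| :=
  summable_abs_const_mul' _ (summable_abs_sub' (summable_abs_comp_add_right (h.pi ι κ) _)
    (summable_abs_const_mul' _ (h.pi (srev ι) κ)))

/-- Row sums of the kernel: `Σ_κ ‖A^{ι,κ}‖₁ ≤ P/(1 − μ_p)`. [cite: FitznerVanDerHofstad2016NoBLE, App. D (D.6)–(D.7) (p. 1111)] -/
theorem nobleKer_row_le (h : NobleL1At d p P X) (ι : Fin d × Bool) :
    ∑ κ, ∑' x, |nobleKer d p ι κ x| ≤ P / (1 - nobleMu d p) := by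
  have hμ0 := nobleMu_nonneg d p
  have hμ1 := h.mu_lt_one
  have hq : 0 < 1 - nobleMu d p ^ 2 := one_sub_mu_sq_pos h
  have hc : |(1 - nobleMu d p ^ 2)⁻¹| = (1 - nobleMu d p ^ 2)⁻¹ := abs_of_pos (inv_pos.2 hq)
  have step : ∀ κ, ∑' x, |nobleKer d p ι κ x| ≤
      (1 - nobleMu d p ^ 2)⁻¹ * ((∑' x, |noblePi d p ι κ x|) + nobleMu d p * ∑' x, |noblePi d p (srev ι) κ x|) :=
    fun κ => by
    have := tsum_abs_smul_sub_le (1 - nobleMu d p ^ 2)⁻¹ (nobleMu d p)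
      (summable_abs_comp_add_right (h.pi ι κ) (𝐞 ι)) (h.pi (srev ι) κ)
    rw [tsum_abs_comp_add_right, hc, abs_of_nonneg hμ0] at this
    exact this
  calc ∑ κ, ∑' x, |nobleKer d p ι κ x|
      ≤ ∑ κ, (1 - nobleMu d p ^ 2)⁻¹ * ((∑' x, |noblePi d p ι κ x|) +
          nobleMu d p * ∑' x, |noblePi d p (srev ι) κ x|) := Finset.sum_le_sum fun κ _ => step κ
    _ = (1 - nobleMu d p ^ 2)⁻¹ * ((∑ κ, ∑' x, |noblePi d p ι κ x|) +
          nobleMu d p * ∑ κ, ∑' x, |noblePi d p (srev ι) κ x|) := by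
        rw [← Finset.mul_sum, Finset.sum_add_distrib, Finset.mul_sum]
    _ ≤ (1 - nobleMu d p ^ 2)⁻¹ * (P + nobleMu d p * P) := by
        refine mul_le_mul_of_nonneg_left (add_le_add (h.pi_le ι)
          (mul_le_mul_of_nonneg_left (h.pi_le (srev ι)) hμ0)) (inv_pos.2 hq).le
    _ = P / (1 - nobleMu d p) := by
        have : (1 : ℝ) - nobleMu d p ≠ 0 := by linarith
        have : (1 : ℝ) + nobleMu d p ≠ 0 := by linarith
        field_simp
        ring

/-- The Neumann ratio `θ = P/(1−μ_p) < 1`. [cite: FitznerVanDerHofstad2016NoBLE, App. D (D.8)] -/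
theorem nobleTheta_lt_one (h : NobleL1At d p P X) : P / (1 - nobleMu d p) < 1 := by
  have : 0 < 1 - nobleMu d p := by linarith [h.mu_lt_one]
  rw [div_lt_one this]
  exact h.P_lt

/-- Auxiliary estimate / unfolding. [folklore] -/
theorem nobleTheta_nonneg [NeZero d] (h : NobleL1At d p P X) : 0 ≤ P / (1 - nobleMu d p) := by
  have : 0 < 1 - nobleMu d p := by linarith [h.mu_lt_one]
  refine div_nonneg ?_ this.le
  obtain ⟨ι⟩ : Nonempty (Fin d × Bool) := ⟨(⟨0, Nat.pos_of_ne_zero (NeZero.ne d)⟩, true)⟩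
  exact le_trans (Finset.sum_nonneg fun κ _ => tsum_nonneg fun _ => abs_nonneg _) (h.pi_le ι)

/-- `u_ι ∈ ℓ¹`, `‖u_ι‖₁ ≤ (1+μ)/(1−μ²)`. [folklore] -/
theorem summable_abs_nobleSeedU (p : unitInterval) (ι : Fin d × Bool) :
    Summable fun x => |nobleSeedU d p ι x| :=
  summable_abs_const_mul' _ (summable_abs_sub' (summable_abs_comp_add_right summable_abs_nobleDelta _)
    (summable_abs_const_mul' _ summable_abs_nobleDelta))

/-- Auxiliary estimate / unfolding. [folklore] -/
theorem tsum_abs_nobleSeedU_le (h : NobleL1At d p P X) (ι : Fin d × Bool) :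
    ∑' x, |nobleSeedU d p ι x| ≤ (1 - nobleMu d p ^ 2)⁻¹ * (1 + nobleMu d p) := by
  have hq := one_sub_mu_sq_pos h
  have := tsum_abs_smul_sub_le (1 - nobleMu d p ^ 2)⁻¹ (nobleMu d p)
    (summable_abs_comp_add_right (summable_abs_nobleDelta (d := d)) (𝐞 ι)) summable_abs_nobleDelta
  rw [tsum_abs_comp_add_right, abs_of_pos (inv_pos.2 hq), abs_of_nonneg (nobleMu_nonneg d p)] at this
  refine this.trans (le_of_eq ?_)
  simp only [abs_nobleDelta, tsum_nobleDelta, mul_one]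

/-- `w_ι ∈ ℓ¹`, `‖w_ι‖₁ ≤ (1+μ)X/(1−μ²)`. [folklore] -/
theorem summable_abs_nobleSeedW (h : NobleL1At d p P X) (ι : Fin d × Bool) :
    Summable fun x => |nobleSeedW d p ι x| :=
  summable_abs_const_mul' _ (summable_abs_sub' (summable_abs_comp_add_right (h.xiIota ι) _)
    (summable_abs_const_mul' _ (h.xiIota (srev ι))))

/-- Auxiliary estimate / unfolding. [folklore] -/
theorem tsum_abs_nobleSeedW_le (h : NobleL1At d p P X) (ι : Fin d × Bool) :
    ∑' x, |nobleSeedW d p ι x| ≤ (1 - nobleMu d p ^ 2)⁻¹ * ((1 + nobleMu d p) * X) := by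
  have hq := one_sub_mu_sq_pos h
  have hμ0 := nobleMu_nonneg d p
  have := tsum_abs_smul_sub_le (1 - nobleMu d p ^ 2)⁻¹ (nobleMu d p)
    (summable_abs_comp_add_right (h.xiIota ι) (𝐞 ι)) (h.xiIota (srev ι))
  rw [tsum_abs_comp_add_right, abs_of_pos (inv_pos.2 hq), abs_of_nonneg hμ0] at this
  refine this.trans (mul_le_mul_of_nonneg_left ?_ (inv_pos.2 hq).le)
  calc (∑' x, |nobleXiIota d p ι x|) + nobleMu d p * ∑' x, |nobleXiIota d p (srev ι) x|
      ≤ X + nobleMu d p * X := add_le_add (h.xiIota_le ι) (mul_le_mul_of_nonneg_left (h.xiIota_le _) hμ0)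
    _ = (1 + nobleMu d p) * X := by ring

/-- `s_ι, s^Ξ_ι ∈ ℓ¹`. [cite: FitznerVanDerHofstad2016NoBLE, App. D (D.8), (D.13)] -/
theorem summable_abs_nobleS [NeZero d] (h : NobleL1At d p P X) (ι : Fin d × Bool) :
    Summable fun x => |nobleS d p ι x| :=
  (kseries_l1 (summable_abs_nobleKer h) (summable_abs_nobleSeedU p) (nobleTheta_nonneg h)
    (nobleTheta_lt_one h) (nobleKer_row_le h) (tsum_abs_nobleSeedU_le h) ι).1

/-- Auxiliary estimate / unfolding. [folklore] -/
theorem summable_abs_nobleSW [NeZero d] (h : NobleL1At d p P X) (ι : Fin d × Bool) :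
    Summable fun x => |nobleSW d p ι x| :=
  (kseries_l1 (summable_abs_nobleKer h) (summable_abs_nobleSeedW h) (nobleTheta_nonneg h)
    (nobleTheta_lt_one h) (nobleKer_row_le h) (tsum_abs_nobleSeedW_le h) ι).1

/-- `F_p ∈ ℓ¹(ℤ^d)`. [cite: FitznerVanDerHofstad2016NoBLE, App. D (D.6)–(D.8) (pp. 1111–1112)] -/
theorem summable_abs_nobleF [NeZero d] (h : NobleL1At d p P X) : Summable fun x => |nobleF d p x| :=
  summable_abs_const_mul' _ (summable_abs_finset_sum' _ fun ι _ =>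
    summable_abs_add' (summable_abs_nobleS h ι) (summable_abs_lconv (h.psi ι) (summable_abs_nobleS h ι)))

/-- `Φ_p ∈ ℓ¹(ℤ^d)`. [cite: FitznerVanDerHofstad2016NoBLE, App. D (D.13) (p. 1112)] -/
theorem summable_abs_noblePhi [NeZero d] (h : NobleL1At d p P X) : Summable fun x => |noblePhi d p x| :=
  summable_abs_sub' (summable_abs_add' summable_abs_nobleDelta h.xi)
    (summable_abs_const_mul' _ (summable_abs_finset_sum' _ fun ι _ =>
      summable_abs_add' (summable_abs_nobleSW h ι) (summable_abs_lconv (h.psi ι) (summable_abs_nobleSW h ι))))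

end Noble

/-! ## D. The NoBLE equations in `k`-space and the identity `Ĝ_p(k)(1 − F̂_p(k)) = Φ̂_p(k)` -/

section KSpace

local notation "𝐞" => Literature.Probability.Percolation.stepVec

variable {p : unitInterval} {P X : ℝ}

/-- Linearity for four summands. [folklore] -/
theorem latticeFT_add4 {f1 f2 f3 f4 : Site d → ℝ} (h1 : Summable fun x => |f1 x|)
    (h2 : Summable fun x => |f2 x|) (h3 : Summable fun x => |f3 x|) (h4 : Summable fun x => |f4 x|)
    (k : Fin d → ℝ) :
    latticeFT (fun x => f1 x + f2 x + f3 x + f4 x) k =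
      latticeFT f1 k + latticeFT f2 k + latticeFT f3 k + latticeFT f4 k := by
  have h12 := summable_abs_add' h1 h2
  have h123 := summable_abs_add' h12 h3
  have e3 : latticeFT (fun x => f1 x + f2 x + f3 x + f4 x) k =
      latticeFT (fun x => f1 x + f2 x + f3 x) k + latticeFT f4 k := latticeFT_add h123 h4 k
  have e2 : latticeFT (fun x => f1 x + f2 x + f3 x) k = latticeFT (fun x => f1 x + f2 x) k + latticeFT f3 k :=
    latticeFT_add h12 h3 k
  have e1 : latticeFT (fun x => f1 x + f2 x) k = latticeFT f1 k + latticeFT f2 k := latticeFT_add h1 h2 k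
  rw [e3, e2, e1]

/-- `y ↦ f(y) b_κ(x − y)` is summable for `f ∈ ℓ¹` (`|b_κ| ≤ 1`). [folklore] -/
theorem summable_mul_nobleTauVec {f : Site d → ℝ} (hf : Summable fun x => |f x|) (κ : Fin d × Bool)
    (x : Site d) : Summable fun y => f y * nobleTauVec d p κ (x - y) :=
  Summable.of_norm_bounded hf fun y => by
    rw [Real.norm_eq_abs, abs_mul]
    exact mul_le_of_le_one_right (abs_nonneg _) (abs_nobleTauVec_le_one _ _)

/-- `Â^{ι,κ}(k) = (e^{ik_ι} Π̂^{ι,κ}(k) − μ Π̂^{−ι,κ}(k))/(1 − μ²)`. [cite: FitznerVanDerHofstad2016NoBLE, (1.31)–(1.33), §4.1.2 (4.10)] -/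
theorem latticeFT_nobleKer (h : NobleL1At d p P X) (ι κ : Fin d × Bool) (k : Fin d → ℝ) :
    latticeFT (nobleKer d p ι κ) k = (1 - ((nobleMu d p : ℝ) : ℂ) ^ 2)⁻¹ *
      (ephase k (𝐞 ι) * latticeFT (noblePi d p ι κ) k -
        ((nobleMu d p : ℝ) : ℂ) * latticeFT (noblePi d p (srev ι) κ) k) := by
  have h1 : latticeFT (fun x => noblePi d p ι κ (x + 𝐞 ι) - nobleMu d p * noblePi d p (srev ι) κ x) k =
      latticeFT (fun x => noblePi d p ι κ (x + 𝐞 ι)) k -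
        latticeFT (fun x => nobleMu d p * noblePi d p (srev ι) κ x) k :=
    latticeFT_sub (summable_abs_comp_add_right (h.pi ι κ) _) (summable_abs_const_mul' _ (h.pi _ κ)) k
  unfold nobleKer
  rw [latticeFT_const_mul, h1, latticeFT_shift, latticeFT_const_mul]
  push_cast
  ring

/-- `û_ι(k) = (e^{ik_ι} − μ)/(1 − μ²)`. [cite: FitznerVanDerHofstad2016NoBLE, §4.1.2 (4.9)] -/
theorem latticeFT_nobleSeedU (p : unitInterval) (ι : Fin d × Bool) (k : Fin d → ℝ) :
    latticeFT (nobleSeedU d p ι) k = (1 - ((nobleMu d p : ℝ) : ℂ) ^ 2)⁻¹ *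
      (ephase k (𝐞 ι) * 1 - ((nobleMu d p : ℝ) : ℂ) * 1) := by
  have h1 : latticeFT (fun x => nobleDelta (x + 𝐞 ι) - nobleMu d p * nobleDelta x) k =
      latticeFT (fun x => nobleDelta (x + 𝐞 ι)) k - latticeFT (fun x => nobleMu d p * nobleDelta x) k :=
    latticeFT_sub (summable_abs_comp_add_right summable_abs_nobleDelta _)
      (summable_abs_const_mul' _ summable_abs_nobleDelta) k
  unfold nobleSeedU
  rw [latticeFT_const_mul, h1, latticeFT_shift, latticeFT_const_mul, nobleDelta_eq_delta0, SpreadOutIsing.latticeFT_delta0]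
  push_cast
  ring

/-- `ŵ_ι(k) = (e^{ik_ι} Ξ̂^ι(k) − μ Ξ̂^{−ι}(k))/(1 − μ²)`. [cite: FitznerVanDerHofstad2016NoBLE, §4.1.2 (4.13)–(4.14)] -/
theorem latticeFT_nobleSeedW (h : NobleL1At d p P X) (ι : Fin d × Bool) (k : Fin d → ℝ) :
    latticeFT (nobleSeedW d p ι) k = (1 - ((nobleMu d p : ℝ) : ℂ) ^ 2)⁻¹ *
      (ephase k (𝐞 ι) * latticeFT (nobleXiIota d p ι) k -
        ((nobleMu d p : ℝ) : ℂ) * latticeFT (nobleXiIota d p (srev ι)) k) := by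
  have h1 : latticeFT (fun x => nobleXiIota d p ι (x + 𝐞 ι) - nobleMu d p * nobleXiIota d p (srev ι) x) k =
      latticeFT (fun x => nobleXiIota d p ι (x + 𝐞 ι)) k -
        latticeFT (fun x => nobleMu d p * nobleXiIota d p (srev ι) x) k :=
    latticeFT_sub (summable_abs_comp_add_right (h.xiIota ι) _) (summable_abs_const_mul' _ (h.xiIota _)) k
  unfold nobleSeedW
  rw [latticeFT_const_mul, h1, latticeFT_shift, latticeFT_const_mul]
  push_cast
  ring

/-- **(1.25) in `k`-space**: `Ĝ(k) = e^{−ik_ι}(e^{ik_ι}τ̂^ι(k)) + μ (e^{ik_{−ι}} τ̂^{−ι}(k)) + Σ_κ Π̂^{ι,κ}(k) e^{ik_κ}τ̂^κ(k) + Ξ̂^ι(k)`,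
i.e. row `ι` of (1.30). [cite: FitznerVanDerHofstad2016NoBLE, (1.25), (1.30) (pp. 1049–1050)] -/
theorem noble_eq_two_hat (h : NobleL1At d p P X) (hE : PercolationNobleEquationAt d p) (ι : Fin d × Bool)
    (k : Fin d → ℝ) :
    latticeFT (tau d p 0) k = ephase k (-𝐞 ι) * latticeFT (nobleTauVec d p ι) k +
      ((nobleMu d p : ℝ) : ℂ) * latticeFT (nobleTauVec d p (srev ι)) k +
      ∑ κ, latticeFT (noblePi d p ι κ) k * latticeFT (nobleTauVec d p κ) k +
      latticeFT (nobleXiIota d p ι) k := by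
  have hb := summable_abs_nobleTauVec h.tau
  have hfun : (tau d p 0) = fun x => nobleTauVec d p ι (x + -𝐞 ι) +
      nobleMu d p * nobleTauVec d p (srev ι) x +
      (∑ κ, lconv (noblePi d p ι κ) (nobleTauVec d p κ) x) + nobleXiIota d p ι x := by
    funext x
    rw [hE.eq_two ι x]
    have e1 : tauOff d p (𝐞 ι) x = nobleTauVec d p ι (x + -𝐞 ι) := by
      simp [nobleTauVec]
    have e2 : tauOff d p (𝐞 (srev ι)) (x - 𝐞 ι) = nobleTauVec d p (srev ι) x := by
      simp [nobleTauVec, sub_eq_add_neg]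
    have e3 : ∑' y, ∑ κ, noblePi d p ι κ y * tauOff d p (𝐞 κ) (x - y + 𝐞 κ) =
        ∑ κ, lconv (noblePi d p ι κ) (nobleTauVec d p κ) x :=
      Summable.tsum_finsetSum fun κ _ => summable_mul_nobleTauVec (h.pi ι κ) κ x
    rw [e1, e2, e3]
  rw [hfun, latticeFT_add4 (summable_abs_comp_add_right (hb ι) _) (summable_abs_const_mul' _ (hb _))
    (summable_abs_finset_sum' _ fun κ _ => summable_abs_lconv (h.pi ι κ) (hb κ)) (h.xiIota ι),
    latticeFT_shift, latticeFT_const_mul,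
    latticeFT_finset_sum _ (fun κ _ => summable_abs_lconv (h.pi ι κ) (hb κ))]
  congr 2
  exact Finset.sum_congr rfl fun κ _ => latticeFT_lconv (h.pi ι κ) (hb κ) k

/-- **(1.24) in `k`-space**: `Ĝ(k) = 1 + Ξ̂(k) + μ Σ_ι (1 + Ψ̂^ι(k)) e^{ik_ι}τ̂^ι(k)`, i.e. (1.29).
[cite: FitznerVanDerHofstad2016NoBLE, (1.24), (1.29) (pp. 1048–1050)] -/
theorem noble_eq_one_hat (h : NobleL1At d p P X) (hE : PercolationNobleEquationAt d p) (k : Fin d → ℝ) :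
    latticeFT (tau d p 0) k = 1 + latticeFT (nobleXi d p) k + ((nobleMu d p : ℝ) : ℂ) *
      ∑ ι, (latticeFT (nobleTauVec d p ι) k + latticeFT (noblePsi d p ι) k * latticeFT (nobleTauVec d p ι) k) := by
  have hb := summable_abs_nobleTauVec h.tau
  have hfun : (tau d p 0) = fun x => nobleDelta x + nobleXi d p x +
      nobleMu d p * ∑ ι, (nobleTauVec d p ι x + lconv (noblePsi d p ι) (nobleTauVec d p ι) x) := by
    funext x
    rw [hE.eq_one x]
    have e3 : ∑' y, ∑ ι, noblePsi d p ι y * tauOff d p (𝐞 ι) (x - y + 𝐞 ι) =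
        ∑ ι, lconv (noblePsi d p ι) (nobleTauVec d p ι) x :=
      Summable.tsum_finsetSum fun ι _ => summable_mul_nobleTauVec (h.psi ι) ι x
    rw [e3, ← Finset.sum_add_distrib]
    rfl
  have hS : ∀ ι, Summable fun x => |nobleTauVec d p ι x + lconv (noblePsi d p ι) (nobleTauVec d p ι) x| :=
    fun ι => summable_abs_add' (hb ι) (summable_abs_lconv (h.psi ι) (hb ι))
  have e12 : latticeFT (fun x => nobleDelta x + nobleXi d p x) k = latticeFT nobleDelta k + latticeFT (nobleXi d p) k :=
    latticeFT_add summable_abs_nobleDelta h.xi k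
  have e123 : latticeFT (fun x => nobleDelta x + nobleXi d p x +
      nobleMu d p * ∑ ι, (nobleTauVec d p ι x + lconv (noblePsi d p ι) (nobleTauVec d p ι) x)) k =
      latticeFT (fun x => nobleDelta x + nobleXi d p x) k +
        latticeFT (fun x => nobleMu d p * ∑ ι, (nobleTauVec d p ι x + lconv (noblePsi d p ι) (nobleTauVec d p ι) x)) k :=
    latticeFT_add (summable_abs_add' summable_abs_nobleDelta h.xi)
      (summable_abs_const_mul' _ (summable_abs_finset_sum' _ fun ι _ => hS ι)) k
  rw [hfun, e123, e12, nobleDelta_eq_delta0, SpreadOutIsing.latticeFT_delta0, latticeFT_const_mul,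
    latticeFT_finset_sum _ (fun ι _ => hS ι)]
  congr 2
  refine Finset.sum_congr rfl fun ι _ => ?_
  have : latticeFT (fun x => nobleTauVec d p ι x + lconv (noblePsi d p ι) (nobleTauVec d p ι) x) k =
      latticeFT (nobleTauVec d p ι) k + latticeFT (lconv (noblePsi d p ι) (nobleTauVec d p ι)) k :=
    latticeFT_add (hb ι) (summable_abs_lconv (h.psi ι) (hb ι)) k
  rw [this, latticeFT_lconv (h.psi ι) (hb ι)]

/-- `F̂_p(k) = μ_p Σ_ι (1 + Ψ̂^ι(k)) ŝ_ι(k)`. [cite: FitznerVanDerHofstad2016NoBLE, (1.34), §4.1.2 (4.8)] -/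
theorem latticeFT_nobleF [NeZero d] (h : NobleL1At d p P X) (k : Fin d → ℝ) :
    latticeFT (nobleF d p) k = ((nobleMu d p : ℝ) : ℂ) *
      ∑ ι, (latticeFT (nobleS d p ι) k + latticeFT (noblePsi d p ι) k * latticeFT (nobleS d p ι) k) := by
  have hs := summable_abs_nobleS h
  have hS : ∀ ι, Summable fun x => |nobleS d p ι x + lconv (noblePsi d p ι) (nobleS d p ι) x| :=
    fun ι => summable_abs_add' (hs ι) (summable_abs_lconv (h.psi ι) (hs ι))
  unfold nobleF
  rw [latticeFT_const_mul, latticeFT_finset_sum _ (fun ι _ => hS ι)]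
  congr 1
  refine Finset.sum_congr rfl fun ι _ => ?_
  have : latticeFT (fun x => nobleS d p ι x + lconv (noblePsi d p ι) (nobleS d p ι) x) k =
      latticeFT (nobleS d p ι) k + latticeFT (lconv (noblePsi d p ι) (nobleS d p ι)) k :=
    latticeFT_add (hs ι) (summable_abs_lconv (h.psi ι) (hs ι)) k
  rw [this, latticeFT_lconv (h.psi ι) (hs ι)]

/-- `Φ̂_p(k) = 1 + Ξ̂_p(k) − μ_p Σ_ι (1 + Ψ̂^ι(k)) ŝ^Ξ_ι(k)`. [cite: FitznerVanDerHofstad2016NoBLE, (1.34), §4.1.2 (4.12)] -/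
theorem latticeFT_noblePhi [NeZero d] (h : NobleL1At d p P X) (k : Fin d → ℝ) :
    latticeFT (noblePhi d p) k = 1 + latticeFT (nobleXi d p) k - ((nobleMu d p : ℝ) : ℂ) *
      ∑ ι, (latticeFT (nobleSW d p ι) k + latticeFT (noblePsi d p ι) k * latticeFT (nobleSW d p ι) k) := by
  have hs := summable_abs_nobleSW h
  have hS : ∀ ι, Summable fun x => |nobleSW d p ι x + lconv (noblePsi d p ι) (nobleSW d p ι) x| :=
    fun ι => summable_abs_add' (hs ι) (summable_abs_lconv (h.psi ι) (hs ι))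
  have e12 : latticeFT (fun x => nobleDelta x + nobleXi d p x) k = latticeFT nobleDelta k + latticeFT (nobleXi d p) k :=
    latticeFT_add summable_abs_nobleDelta h.xi k
  have e : latticeFT (noblePhi d p) k = latticeFT (fun x => nobleDelta x + nobleXi d p x) k -
      latticeFT (fun x => nobleMu d p * ∑ ι, (nobleSW d p ι x + lconv (noblePsi d p ι) (nobleSW d p ι) x)) k :=
    latticeFT_sub (summable_abs_add' summable_abs_nobleDelta h.xi)
      (summable_abs_const_mul' _ (summable_abs_finset_sum' _ fun ι _ => hS ι)) k
  rw [e, e12, nobleDelta_eq_delta0, SpreadOutIsing.latticeFT_delta0, latticeFT_const_mul,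
    latticeFT_finset_sum _ (fun ι _ => hS ι)]
  congr 2
  refine Finset.sum_congr rfl fun ι _ => ?_
  have : latticeFT (fun x => nobleSW d p ι x + lconv (noblePsi d p ι) (nobleSW d p ι) x) k =
      latticeFT (nobleSW d p ι) k + latticeFT (lconv (noblePsi d p ι) (nobleSW d p ι)) k :=
    latticeFT_add (hs ι) (summable_abs_lconv (h.psi ι) (hs ι)) k
  rw [this, latticeFT_lconv (h.psi ι) (hs ι)]

end KSpace

/-! ## E. Solving the system: `(D̂_k + μJ + Π̂)ŝ = 1⃗`, `(D̂_k + μJ + Π̂)ŝ^Ξ = Ξ⃗`, and `Ĝ(1 − F̂) = Φ̂` -/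

section Solve

local notation "𝐞" => Literature.Probability.Percolation.stepVec

variable {p : unitInterval} {P X : ℝ} [NeZero d]

/-- **The resummed vectors solve the `2d × 2d` system** ([NoBLE17] (1.30)–(1.33) without inverses): for every `k`,
`(D̂_k + μ_pJ + Π̂_p(k)) ŝ(k) = 1⃗`, `(D̂_k + μ_pJ + Π̂_p(k)) ŝ^Ξ(k) = Ξ⃗_p(k)`, and consequently — the
matrix being injective by the max-norm contraction `Σ_κ|Â^{ι,κ}(k)| ≤ P/(1−μ_p) < 1` — the unique solution
of (1.30) is `e^{ik_ι}τ̂^ι_p(k) = Ĝ_p(k) ŝ_ι(k) − ŝ^Ξ_ι(k)` (this is (1.33)).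
[cite: FitznerVanDerHofstad2016NoBLE, (1.30)–(1.33) (p. 1050); §4.1.2 (p. 1082)] -/
theorem noble_kspace_solution (h : NobleL1At d p P X) (hE : PercolationNobleEquationAt d p) (k : Fin d → ℝ) :
    (∀ ι, ephase k (-𝐞 ι) * latticeFT (nobleS d p ι) k +
        ((nobleMu d p : ℝ) : ℂ) * latticeFT (nobleS d p (srev ι)) k +
        ∑ κ, latticeFT (noblePi d p ι κ) k * latticeFT (nobleS d p κ) k = 1) ∧
    (∀ ι, ephase k (-𝐞 ι) * latticeFT (nobleSW d p ι) k +
        ((nobleMu d p : ℝ) : ℂ) * latticeFT (nobleSW d p (srev ι)) k +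
        ∑ κ, latticeFT (noblePi d p ι κ) k * latticeFT (nobleSW d p κ) k = latticeFT (nobleXiIota d p ι) k) ∧
    (∀ ι, latticeFT (nobleTauVec d p ι) k =
        latticeFT (tau d p 0) k * latticeFT (nobleS d p ι) k - latticeFT (nobleSW d p ι) k) := by
  have hEE : ∀ i : Fin d × Bool, ephase k (-𝐞 i) * ephase k (𝐞 i) = 1 := fun i => ephase_neg_mul k _
  have hErev : ∀ i : Fin d × Bool, ephase k (𝐞 (srev i)) = ephase k (-𝐞 i) := fun i => by
    rw [stepVec_srev]
  have hμ2 : (1 : ℂ) - ((nobleMu d p : ℝ) : ℂ) ^ 2 ≠ 0 := by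
    have := (one_sub_mu_sq_pos h).ne'
    exact_mod_cast this
  have hA : ∀ i κ : Fin d × Bool, latticeFT (nobleKer d p i κ) k = (1 - ((nobleMu d p : ℝ) : ℂ) ^ 2)⁻¹ *
      (ephase k (𝐞 i) * latticeFT (noblePi d p i κ) k -
        ((nobleMu d p : ℝ) : ℂ) * latticeFT (noblePi d p (srev i) κ) k) := fun i κ => latticeFT_nobleKer h i κ k
  have hθ0 := nobleTheta_nonneg h
  have hθ1 := nobleTheta_lt_one h
  -- the two Neumann identities
  have hNs : ∀ ι, latticeFT (nobleS d p ι) k + ∑ κ, latticeFT (nobleKer d p ι κ) k * latticeFT (nobleS d p κ) k =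
      (1 - ((nobleMu d p : ℝ) : ℂ) ^ 2)⁻¹ * (ephase k (𝐞 ι) * (fun _ => (1 : ℂ)) ι -
        ((nobleMu d p : ℝ) : ℂ) * (fun _ => (1 : ℂ)) (srev ι)) := fun ι => by
    have := kseries_neumann (summable_abs_nobleKer h) (summable_abs_nobleSeedU p) hθ0 hθ1
      (nobleKer_row_le h) (tsum_abs_nobleSeedU_le h) ι k
    rw [latticeFT_nobleSeedU] at this
    exact this
  have hNw : ∀ ι, latticeFT (nobleSW d p ι) k + ∑ κ, latticeFT (nobleKer d p ι κ) k * latticeFT (nobleSW d p κ) k =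
      (1 - ((nobleMu d p : ℝ) : ℂ) ^ 2)⁻¹ * (ephase k (𝐞 ι) * latticeFT (nobleXiIota d p ι) k -
        ((nobleMu d p : ℝ) : ℂ) * latticeFT (nobleXiIota d p (srev ι)) k) := fun ι => by
    have := kseries_neumann (summable_abs_nobleKer h) (summable_abs_nobleSeedW h) hθ0 hθ1
      (nobleKer_row_le h) (tsum_abs_nobleSeedW_le h) ι k
    rw [latticeFT_nobleSeedW h] at this
    exact this
  have hMs := vec_solve (K := ℂ) srev srev_srev hEE hErev hμ2 hA (fun _ => (1 : ℂ)) hNs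
  have hMw := vec_solve (K := ℂ) srev srev_srev hEE hErev hμ2 hA (fun ι => latticeFT (nobleXiIota d p ι) k) hNw
  refine ⟨hMs, hMw, ?_⟩
  -- uniqueness: the difference `z = τ⃗ − (Ĝ ŝ − ŝ^Ξ)` solves the homogeneous system
  have hE2 := noble_eq_two_hat h hE
  have hz : ∀ i : Fin d × Bool,
      ephase k (-𝐞 i) * (latticeFT (nobleTauVec d p i) k -
          (latticeFT (tau d p 0) k * latticeFT (nobleS d p i) k - latticeFT (nobleSW d p i) k)) +
        ((nobleMu d p : ℝ) : ℂ) * (latticeFT (nobleTauVec d p (srev i)) k -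
          (latticeFT (tau d p 0) k * latticeFT (nobleS d p (srev i)) k - latticeFT (nobleSW d p (srev i)) k)) +
        ∑ κ, latticeFT (noblePi d p i κ) k * (latticeFT (nobleTauVec d p κ) k -
          (latticeFT (tau d p 0) k * latticeFT (nobleS d p κ) k - latticeFT (nobleSW d p κ) k)) = 0 := by
    intro i
    have hsum : ∑ κ, latticeFT (noblePi d p i κ) k * (latticeFT (nobleTauVec d p κ) k -
          (latticeFT (tau d p 0) k * latticeFT (nobleS d p κ) k - latticeFT (nobleSW d p κ) k)) =
        ∑ κ, latticeFT (noblePi d p i κ) k * latticeFT (nobleTauVec d p κ) k -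
          latticeFT (tau d p 0) k * ∑ κ, latticeFT (noblePi d p i κ) k * latticeFT (nobleS d p κ) k +
          ∑ κ, latticeFT (noblePi d p i κ) k * latticeFT (nobleSW d p κ) k := by
      have : ∀ κ, latticeFT (noblePi d p i κ) k * (latticeFT (nobleTauVec d p κ) k -
          (latticeFT (tau d p 0) k * latticeFT (nobleS d p κ) k - latticeFT (nobleSW d p κ) k)) =
          latticeFT (noblePi d p i κ) k * latticeFT (nobleTauVec d p κ) k -
            latticeFT (tau d p 0) k * (latticeFT (noblePi d p i κ) k * latticeFT (nobleS d p κ) k) +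
            latticeFT (noblePi d p i κ) k * latticeFT (nobleSW d p κ) k := fun κ => by ring
      simp only [this, Finset.sum_add_distrib, Finset.sum_sub_distrib, ← Finset.mul_sum]
    rw [hsum]
    linear_combination (-1 : ℂ) * hE2 i k - latticeFT (tau d p 0) k * hMs i + hMw i
  have hker := vec_kernel (K := ℂ) srev srev_srev hEE hErev hμ2 hA hz
  have ha : ∀ i : Fin d × Bool, ∑ κ, ‖latticeFT (nobleKer d p i κ) k‖ ≤ P / (1 - nobleMu d p) := fun i =>
    (Finset.sum_le_sum fun κ _ => norm_latticeFT_le (summable_abs_nobleKer h i κ) k).trans (nobleKer_row_le h i)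
  have hz0 := vec_eq_zero_of_contraction hθ1 ha hker
  intro ι
  have := congrFun hz0 ι
  simpa [sub_eq_zero] using this

/-- **The NoBLE `k`-space identity for percolation, kernel-proved**: for every `p` at which the `x`-space
NoBLE equations hold and the coefficients are `ℓ¹` with `Σ_κ‖Π^{ι,κ}_p‖₁ ≤ P < 1 − μ_p`, and EVERY `k`,
`Ĝ_p(k) (1 − F̂_p(k)) = Φ̂_p(k)` with the explicit `ℓ¹` functions `F_p = μ_pΣ_ι(s_ι + Ψ^ι_p ⋆ s_ι)`,
`Φ_p = δ + Ξ_p − μ_pΣ_ι(s^Ξ_ι + Ψ^ι_p ⋆ s^Ξ_ι)` — [NoBLE17] (1.34) "`Ĝ_z(k) = Φ̂_z(k)/(1 − F̂_z(k))`" in the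
division-free form (no characteristic-function or `p < p_c`-specific input beyond the hypotheses).
[cite: FitznerVanDerHofstad2016NoBLE, §1.3 (1.29)–(1.34) (pp. 1049–1050); §4.1.2 (4.8)–(4.14) (p. 1082)] -/
theorem noble_kspace_identity (h : NobleL1At d p P X) (hE : PercolationNobleEquationAt d p) (k : Fin d → ℝ) :
    latticeFT (tau d p 0) k * (1 - latticeFT (nobleF d p) k) = latticeFT (noblePhi d p) k := by
  obtain ⟨-, -, hv⟩ := noble_kspace_solution h hE k
  rw [latticeFT_nobleF h, latticeFT_noblePhi h]
  have e1 := noble_eq_one_hat h hE k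
  simp only [hv] at e1
  have hsum : ∑ ι, (latticeFT (tau d p 0) k * latticeFT (nobleS d p ι) k - latticeFT (nobleSW d p ι) k +
        latticeFT (noblePsi d p ι) k * (latticeFT (tau d p 0) k * latticeFT (nobleS d p ι) k - latticeFT (nobleSW d p ι) k)) =
      latticeFT (tau d p 0) k * ∑ ι, (latticeFT (nobleS d p ι) k + latticeFT (noblePsi d p ι) k * latticeFT (nobleS d p ι) k) -
        ∑ ι, (latticeFT (nobleSW d p ι) k + latticeFT (noblePsi d p ι) k * latticeFT (nobleSW d p ι) k) := by
    have : ∀ ι, latticeFT (tau d p 0) k * latticeFT (nobleS d p ι) k - latticeFT (nobleSW d p ι) k +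
        latticeFT (noblePsi d p ι) k * (latticeFT (tau d p 0) k * latticeFT (nobleS d p ι) k - latticeFT (nobleSW d p ι) k) =
        latticeFT (tau d p 0) k * (latticeFT (nobleS d p ι) k + latticeFT (noblePsi d p ι) k * latticeFT (nobleS d p ι) k) -
          (latticeFT (nobleSW d p ι) k + latticeFT (noblePsi d p ι) k * latticeFT (nobleSW d p ι) k) := fun ι => by ring
    simp only [this, Finset.sum_sub_distrib, ← Finset.mul_sum]
  rw [hsum] at e1
  linear_combination e1

end Solve

/-! ## F. Real form, the values at `k = 0` ([NoBLE17] Lemma 3.1), `λ_p`, and the split-off of `δ` and `D̂` -/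

section Real

local notation "𝐞" => Literature.Probability.Percolation.stepVec

variable {p : unitInterval} {P X : ℝ}

/-- `f̂(0) = Σ_x f(x)` for the complex transform. [folklore] -/
theorem latticeFT_at_zero (f : Site d → ℝ) : latticeFT f 0 = ((∑' x, f x : ℝ) : ℂ) := by
  unfold latticeFT
  rw [Complex.ofReal_tsum]
  exact tsum_congr fun x => by simp

/-- Auxiliary estimate / unfolding. [folklore] -/
theorem ephase_zero (v : Site d) : ephase (0 : Fin d → ℝ) v = 1 := by
  simp [ephase]

/-- `|Σ_x f x| ≤ Σ_x |f x|`. [folklore] -/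
theorem abs_tsum_le_tsum_abs' {f : Site d → ℝ} (hf : Summable fun x => |f x|) : |∑' x, f x| ≤ ∑' x, |f x| := by
  rw [← Real.norm_eq_abs]
  have h := norm_tsum_le_tsum_norm (f := f) (by simpa [Real.norm_eq_abs] using hf)
  simpa [Real.norm_eq_abs] using h

variable [NeZero d]

/-- **Real form of the `k`-space identity**: `τ̂_p(k) (1 − F̂_p(k)) = Φ̂_p(k)` with the COSINE transforms
`F̂_p = cosFT F_p`, `Φ̂_p = cosFT Φ_p` (`τ_p` is even, so `Ĝ_p(k) = τ̂_p(k)` is real, and the real part of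
`Ĝ(1 − F̂) = Φ̂` is the displayed identity). [cite: FitznerVanDerHofstad2016NoBLE, (1.34) (p. 1050); Prop. 4.5(ii)/(4.35) first line (p. 1087)] -/
theorem noble_real_identity (h : NobleL1At d p P X) (hE : PercolationNobleEquationAt d p) (k : Fin d → ℝ) :
    tauHat d p k * (1 - cosFT (nobleF d p) k) = cosFT (noblePhi d p) k := by
  have hc := noble_kspace_identity h hE k
  have hτ : Summable fun x => |tau d p 0 x| := h.tau.abs
  have him : (latticeFT (tau d p 0) k).im = 0 := latticeFT_im_eq_zero_of_even hτ (tau_zero_symm p) k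
  have hre := congrArg Complex.re hc
  rw [Complex.mul_re, him, zero_mul, sub_zero, Complex.sub_re, Complex.one_re, re_latticeFT_eq_cosFT hτ,
    re_latticeFT_eq_cosFT (summable_abs_nobleF h), re_latticeFT_eq_cosFT (summable_abs_noblePhi h)] at hre
  rw [tauHat_eq_cosFT]
  exact hre

/-- The involution `ι ↦ −ι` as a permutation. [folklore] -/
def srevEquiv (d : ℕ) : (Fin d × Bool) ≃ (Fin d × Bool) := ⟨srev, srev, srev_srev, srev_srev⟩

/-- **[NoBLE17] Lemma 3.1 for percolation, at the level of sums** (`k = 0`): with `π_p = Σ_κ Π̂^{ι,κ}_p(0)`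
(row sums = column sums), `ξ^ι_p = Ξ̂^ι_p(0)` (independent of `ι`) and `ψ_p = Ψ̂^κ_p(0)` (independent of `κ`):
`1 + μ_p + π_p > 0`, `(1 + μ_p + π_p) Σ_ι ŝ_ι(0) = 2d`, `(1 + μ_p + π_p) Σ_ι ŝ^Ξ_ι(0) = 2d ξ^ι_p`,
`F̂_p(0) = μ_p(1+ψ_p) Σ_ι ŝ_ι(0)`, `Φ̂_p(0) = 1 + Ξ̂_p(0) − μ_p(1+ψ_p)Σ_ι ŝ^Ξ_ι(0)` and `χ_p (1 − F̂_p(0)) = Φ̂_p(0)`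
— i.e. `F̂_p(0) = 2dμ_p(1+ψ_p)/(1+μ_p+π_p)` as in the proof of Lemma 3.1 ("we use (1.32) and (1.34)").
[cite: FitznerVanDerHofstad2016NoBLE, Lemma 3.1 (3.1)–(3.2) and its proof (pp. 1065–1066)] -/
theorem noble_sums_at_zero (h : NobleL1At d p P X) (hE : PercolationNobleEquationAt d p) {ψ π ξι : ℝ}
    (hψ : ∀ ι, ∑' x, noblePsi d p ι x = ψ) (hπrow : ∀ ι, ∑ κ, ∑' x, noblePi d p ι κ x = π)
    (hπcol : ∀ κ, ∑ ι, ∑' x, noblePi d p ι κ x = π) (hξι : ∀ ι, ∑' x, nobleXiIota d p ι x = ξι) :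
    0 < 1 + nobleMu d p + π ∧
    (1 + nobleMu d p + π) * ∑ ι, ∑' x, nobleS d p ι x = 2 * d ∧
    (1 + nobleMu d p + π) * ∑ ι, ∑' x, nobleSW d p ι x = 2 * d * ξι ∧
    ∑' x, nobleF d p x = nobleMu d p * (1 + ψ) * ∑ ι, ∑' x, nobleS d p ι x ∧
    ∑' x, noblePhi d p x = 1 + ∑' x, nobleXi d p x - nobleMu d p * (1 + ψ) * ∑ ι, ∑' x, nobleSW d p ι x ∧
    (∑' x, tau d p 0 x) * (1 - ∑' x, nobleF d p x) = ∑' x, noblePhi d p x := by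
  obtain ⟨hMs, hMw, -⟩ := noble_kspace_solution h hE 0
  have hcard : (Fintype.card (Fin d × Bool) : ℝ) = 2 * d := by
    rw [Fintype.card_prod, Fintype.card_fin, Fintype.card_bool]; push_cast; ring
  -- positivity of `1 + μ + π`
  have hπabs : |π| ≤ P := by
    obtain ⟨ι⟩ : Nonempty (Fin d × Bool) := ⟨(⟨0, Nat.pos_of_ne_zero (NeZero.ne d)⟩, true)⟩
    rw [← hπrow ι]
    refine (Finset.abs_sum_le_sum_abs _ _).trans ((Finset.sum_le_sum fun κ _ => abs_tsum_le_tsum_abs' (h.pi ι κ)).trans (h.pi_le ι))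
  have hpos : 0 < 1 + nobleMu d p + π := by
    have := h.P_lt; have := nobleMu_nonneg d p; have := neg_abs_le π; linarith
  -- the two systems at `k = 0`, as real identities
  have hS : ∀ ι, (∑' x, nobleS d p ι x) + nobleMu d p * (∑' x, nobleS d p (srev ι) x) +
      ∑ κ, (∑' x, noblePi d p ι κ x) * (∑' x, nobleS d p κ x) = 1 := fun ι => by
    have e := hMs ι
    simp only [ephase_zero, one_mul, latticeFT_at_zero] at e
    exact_mod_cast e
  have hSW : ∀ ι, (∑' x, nobleSW d p ι x) + nobleMu d p * (∑' x, nobleSW d p (srev ι) x) +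
      ∑ κ, (∑' x, noblePi d p ι κ x) * (∑' x, nobleSW d p κ x) = ξι := fun ι => by
    have e := hMw ι
    simp only [ephase_zero, one_mul, latticeFT_at_zero, hξι] at e
    exact_mod_cast e
  have v1 := noble_sum_vector_identity (srevEquiv d) (G := (1 : ℝ)) (μ := nobleMu d p) (π := π)
    (Gv := fun ι => ∑' x, nobleS d p ι x) (Ξv := fun _ => (0 : ℝ))
    (Pm := fun ι κ => ∑' x, noblePi d p ι κ x) hπcol (fun ι => by simpa [srevEquiv] using (hS ι).symm)
  have v2 := noble_sum_vector_identity (srevEquiv d) (G := ξι) (μ := nobleMu d p) (π := π)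
    (Gv := fun ι => ∑' x, nobleSW d p ι x) (Ξv := fun _ => (0 : ℝ))
    (Pm := fun ι κ => ∑' x, noblePi d p ι κ x) hπcol (fun ι => by simpa [srevEquiv] using (hSW ι).symm)
  simp only [Finset.sum_const_zero, add_zero, hcard, mul_one] at v1 v2
  refine ⟨hpos, v1.symm, by rw [← v2], ?_, ?_, ?_⟩
  · have e := latticeFT_nobleF h (0 : Fin d → ℝ)
    simp only [latticeFT_at_zero, hψ] at e
    have e' : (∑' x, nobleF d p x) = nobleMu d p * ∑ ι, ((∑' x, nobleS d p ι x) + ψ * ∑' x, nobleS d p ι x) := by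
      exact_mod_cast e
    rw [e', Finset.mul_sum, Finset.mul_sum]
    exact Finset.sum_congr rfl fun ι _ => by ring
  · have e := latticeFT_noblePhi h (0 : Fin d → ℝ)
    simp only [latticeFT_at_zero, hψ] at e
    have e' : (∑' x, noblePhi d p x) = 1 + (∑' x, nobleXi d p x) -
        nobleMu d p * ∑ ι, ((∑' x, nobleSW d p ι x) + ψ * ∑' x, nobleSW d p ι x) := by
      exact_mod_cast e
    rw [e', Finset.mul_sum, Finset.mul_sum]
    congr 1
    exact Finset.sum_congr rfl fun ι _ => by ring
  · have e := noble_kspace_identity h hE 0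
    simp only [latticeFT_at_zero] at e
    exact_mod_cast e

/-- **`λ_p` of [NoBLE17] Lemma 3.1 (3.1)**: the solution of `λ(1 + π_p − μ_pψ_p) = μ_p(1 + ψ_p)`, i.e. of
`μ_p = (1+π_p)λ/(1 + (1+λ)ψ_p)` ((3.1) rearranged as in the proof of Lemma 3.1).
[cite: FitznerVanDerHofstad2016NoBLE, Lemma 3.1 (3.1) (p. 1065)] -/
def nobleLam (d : ℕ) (p : unitInterval) (ψ π : ℝ) : ℝ :=
  nobleMu d p * (1 + ψ) / (1 + π - nobleMu d p * ψ)

/-- **[NoBLE17] Lemma 3.1 for percolation with the signs**: under `1 + ψ_p > 0` and `Σ|Ξ_p| + Σ|Ξ^ι_p| < 1`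
(numerical side conditions; cf. Assumption 2.7 "Further, we assume … c_Φ − β_{α,Φ} − β_{R,Φ} > 0"), with
`λ = λ_p`: `0 ≤ λ`, `(2d−1)λ < 1`, `μ_p = (1+π_p)λ/(1+ψ_p(1+λ))` (3.1), `F̂_p(0) = 2dλ/(1+λ)` (3.2),
`Φ̂_p(0) > 0` and `F̂_p(0) < 1`. [cite: FitznerVanDerHofstad2016NoBLE, Lemma 3.1 (3.1)–(3.2) (pp. 1065–1066); Assumption 2.7 (p. 1059)] -/
theorem noble_lemma31 (h : NobleL1At d p P X) (hE : PercolationNobleEquationAt d p) (hμ0 : 0 < nobleMu d p)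
    {ψ π ξι : ℝ} (hψ : ∀ ι, ∑' x, noblePsi d p ι x = ψ) (hπrow : ∀ ι, ∑ κ, ∑' x, noblePi d p ι κ x = π)
    (hπcol : ∀ κ, ∑ ι, ∑' x, noblePi d p ι κ x = π) (hξι : ∀ ι, ∑' x, nobleXiIota d p ι x = ξι)
    (hψ1 : -1 < ψ) (hsmall : (∑' x, |nobleXi d p x|) + X < 1) :
    0 ≤ nobleLam d p ψ π ∧ (2 * d - 1) * nobleLam d p ψ π < 1 ∧
    nobleMu d p = (1 + π) * nobleLam d p ψ π / (1 + ψ * (1 + nobleLam d p ψ π)) ∧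
    ∑' x, nobleF d p x = 2 * d * nobleLam d p ψ π / (1 + nobleLam d p ψ π) ∧
    0 < ∑' x, noblePhi d p x ∧ ∑' x, nobleF d p x < 1 ∧ 0 < 1 + nobleMu d p + π := by
  obtain ⟨hA, hS, hSW, hF, hΦ, hχ⟩ := noble_sums_at_zero h hE hψ hπrow hπcol hξι
  set μ := nobleMu d p with hμ
  set A := 1 + μ + π with hAdef
  set F0 := ∑' x, nobleF d p x with hF0
  set Φ0 := ∑' x, noblePhi d p x with hΦ0
  set χ := ∑' x, tau d p 0 x with hχdef
  set ξ := ∑' x, nobleXi d p x with hξ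
  set n : ℝ := 2 * d with hn
  have hn1 : 2 ≤ n := by
    have : (1 : ℝ) ≤ d := by exact_mod_cast Nat.pos_of_ne_zero (NeZero.ne d)
    rw [hn]; linarith
  -- `χ ≥ 1`, `|ξ| ≤ Σ|Ξ|`, `|ξι| ≤ X`
  have hχ1 : 1 ≤ χ := by
    have := h.tau.le_tsum (0 : Site d) (fun y _ => tau_nonneg p 0 y)
    rw [tau_self] at this
    exact this
  have hξabs : |ξ| ≤ ∑' x, |nobleXi d p x| := abs_tsum_le_tsum_abs' h.xi
  have hξιabs : |ξι| ≤ X := by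
    obtain ⟨ι⟩ : Nonempty (Fin d × Bool) := ⟨(⟨0, Nat.pos_of_ne_zero (NeZero.ne d)⟩, true)⟩
    rw [← hξι ι]
    exact (abs_tsum_le_tsum_abs' (h.xiIota ι)).trans (h.xiIota_le ι)
  -- sums of `s`, `s^Ξ`
  have hSumS : ∑ ι, ∑' x, nobleS d p ι x = n / A := by
    rw [eq_div_iff hA.ne']; rw [hn]; linarith [hS]
  have hSumSW : ∑ ι, ∑' x, nobleSW d p ι x = n * ξι / A := by
    rw [eq_div_iff hA.ne']; rw [hn]; linarith [hSW]
  have hF0 : F0 = μ * (1 + ψ) * n / A := by rw [hF, hSumS]; ring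
  have hΦ0' : Φ0 = 1 + ξ - F0 * ξι := by rw [hΦ, hSumSW, hF0]; field_simp
  -- `(χ − ξι)(1 − F0) = 1 + ξ − ξι > 0` forces `F0 < 1`
  have hkey : (χ - ξι) * (1 - F0) = 1 + ξ - ξι := by
    have := hχ; rw [hΦ0'] at this; linear_combination this
  have h1 : 0 < 1 + ξ - ξι := by
    have := neg_abs_le ξ; have := le_abs_self ξι
    have : 0 ≤ ∑' x, |nobleXi d p x| := tsum_nonneg fun _ => abs_nonneg _
    linarith
  have h2 : 0 < χ - ξι := by
    have := le_abs_self ξι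
    have : 0 ≤ ∑' x, |nobleXi d p x| := tsum_nonneg fun _ => abs_nonneg _
    linarith
  have hF1 : F0 < 1 := by
    by_contra hc
    have hc' : 1 ≤ F0 := not_lt.mp hc
    have : (χ - ξι) * (1 - F0) ≤ 0 := mul_nonpos_of_nonneg_of_nonpos h2.le (by linarith)
    linarith
  have hΦpos : 0 < Φ0 := by
    rw [← hχ]; exact mul_pos (by linarith) (by linarith)
  -- the denominator `D = 1 + π − μψ = A − μ(1+ψ) > (n−1) μ (1+ψ) ≥ 0`
  have hμψ : 0 ≤ μ * (1 + ψ) := mul_nonneg hμ0.le (by linarith)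
  have hlt : μ * (1 + ψ) * n < A := by
    have : μ * (1 + ψ) * n / A < 1 := by rw [← hF0]; exact hF1
    rwa [div_lt_one hA] at this
  have hD : 0 < 1 + π - μ * ψ := by nlinarith
  have hDμ : (n - 1) * (μ * (1 + ψ)) < 1 + π - μ * ψ := by nlinarith
  have hlam_def : nobleLam d p ψ π = μ * (1 + ψ) / (1 + π - μ * ψ) := rfl
  have hlam0 : 0 ≤ nobleLam d p ψ π := by rw [hlam_def]; exact div_nonneg hμψ hD.le
  have hlam_eq : nobleLam d p ψ π * (1 + π - μ * ψ) = μ * (1 + ψ) := by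
    rw [hlam_def]; field_simp
  have hlam_lt : (n - 1) * nobleLam d p ψ π < 1 := by
    rw [hlam_def, ← mul_div_assoc, div_lt_one hD]; exact hDμ
  obtain ⟨l1, l2⟩ := noble_link_lambda (n := n) hlam_eq
  -- `1 + π > 0`, `λ > 0`, hence `1 + ψ(1+λ) > 0`
  have hπabs : |π| ≤ P := by
    obtain ⟨ι⟩ : Nonempty (Fin d × Bool) := ⟨(⟨0, Nat.pos_of_ne_zero (NeZero.ne d)⟩, true)⟩
    rw [← hπrow ι]
    refine (Finset.abs_sum_le_sum_abs _ _).trans ((Finset.sum_le_sum fun κ _ => abs_tsum_le_tsum_abs' (h.pi ι κ)).trans (h.pi_le ι))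
  have hπ1 : 0 < 1 + π := by
    have := h.P_lt; have := neg_abs_le π; linarith
  have hlam_pos : 0 < nobleLam d p ψ π := by
    rw [hlam_def]; exact div_pos (mul_pos hμ0 (by linarith)) hD
  have hden : 0 < 1 + ψ * (1 + nobleLam d p ψ π) := by
    have : μ * (1 + ψ * (1 + nobleLam d p ψ π)) = (1 + π) * nobleLam d p ψ π := l1
    have hprod : 0 < μ * (1 + ψ * (1 + nobleLam d p ψ π)) := by rw [this]; exact mul_pos hπ1 hlam_pos
    exact pos_of_mul_pos_right hprod hμ0.le
  refine ⟨hlam0, hlam_lt, ?_, ?_, hΦpos, hF1, hA⟩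
  · rw [eq_div_iff hden.ne']; linear_combination l1
  · have hl1 : 0 < 1 + nobleLam d p ψ π := by linarith
    rw [eq_div_iff hl1.ne', hF0]
    have hA0 : A ≠ 0 := hA.ne'
    have : μ * (1 + ψ) * n / A * (1 + nobleLam d p ψ π) * A = n * nobleLam d p ψ π * A := by
      rw [div_mul_eq_mul_div, div_mul_cancel₀ _ hA0]; linear_combination l2
    calc μ * (1 + ψ) * n / A * (1 + nobleLam d p ψ π)
        = (μ * (1 + ψ) * n / A * (1 + nobleLam d p ψ π) * A) / A := by field_simp
      _ = n * nobleLam d p ψ π * A / A := by rw [this]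
      _ = n * nobleLam d p ψ π := by rw [mul_div_assoc, div_self hA0, mul_one]

end Real

/-! ## G. Splitting off `δ` and `D̂`; the assembly into `NobleSimplifiedFormAt` -/

section Assembly

variable {p : unitInterval} {P X : ℝ}

/-- `Σ_j (δ_{0,x−e_j} + δ_{0,x+e_j})`: the nearest-neighbour indicator (`2d D(x)`), whose cosine transform
is `2d D̂(k)`. [folklore] -/
def nobleNN (x : Site d) : ℝ := ∑ j : Fin d, (nobleDelta (x - Pi.single j 1) + nobleDelta (x + Pi.single j 1))

/-- Auxiliary estimate / unfolding. [folklore] -/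
theorem nobleDelta_neg (x : Site d) : nobleDelta (-x) = nobleDelta x := by
  simp [nobleDelta, neg_eq_zero]

/-- Auxiliary estimate / unfolding. [folklore] -/
theorem summable_abs_nobleNN : Summable fun x : Site d => |nobleNN x| := by
  unfold nobleNN
  refine summable_abs_finset_sum' Finset.univ fun j _ => ?_
  have h1 : Summable fun x : Site d => |nobleDelta (x - Pi.single j 1)| := by
    simpa [sub_eq_add_neg] using summable_abs_comp_add_right summable_abs_nobleDelta (-(Pi.single j (1 : ℤ)))
  have h2 : Summable fun x : Site d => |nobleDelta (x + Pi.single j 1)| :=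
    summable_abs_comp_add_right summable_abs_nobleDelta (Pi.single j (1 : ℤ))
  exact Summable.of_nonneg_of_le (fun _ => abs_nonneg _) (fun x => abs_add_le _ _) (h1.add h2)

/-- `cosFT δ_0 = 1`. [folklore] -/
theorem cosFT_nobleDelta (k : Fin d → ℝ) : cosFT (nobleDelta (d := d)) k = 1 := by
  rw [cosFT, tsum_eq_single 0 fun x hx => by simp [nobleDelta, hx]]
  simp [nobleDelta]

/-- `cosFT (Σ_j (δ_{x−e_j} + δ_{x+e_j})) = 2d D̂(k)`. [folklore] -/
theorem cosFT_nobleNN [NeZero d] (k : Fin d → ℝ) : cosFT (nobleNN (d := d)) k = 2 * d * Dhat d k := by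
  have h := cosFT_nnShiftSum (d := d) summable_nobleDelta nobleDelta_neg k
  rw [cosFT_nobleDelta, mul_one] at h
  exact h

/-- Linearity of the cosine transform (three terms). [folklore] -/
theorem cosFT_sub_sub {f g h : Site d → ℝ} (hf : Summable fun x => |f x|) (hg : Summable fun x => |g x|)
    (hh : Summable fun x => |h x|) (c a : ℝ) (k : Fin d → ℝ) :
    cosFT (fun x => f x - c * g x - a * h x) k = cosFT f k - c * cosFT g k - a * cosFT h k := by
  unfold cosFT
  have h1 := summable_cos_kdot_mul hf.of_abs k
  have h2 := summable_cos_kdot_mul hg.of_abs k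
  have h3 := summable_cos_kdot_mul hh.of_abs k
  have e : ∀ x, Real.cos (kdot k x) * (f x - c * g x - a * h x)
      = Real.cos (kdot k x) * f x - c * (Real.cos (kdot k x) * g x) - a * (Real.cos (kdot k x) * h x) :=
    fun x => by ring
  simp_rw [e]
  rw [(h1.sub (h2.mul_left c)).tsum_sub (h3.mul_left a), h1.tsum_sub (h2.mul_left c), tsum_mul_left, tsum_mul_left]

/-- The remainder `R(x) = f(x) − c δ_{0,x} − (α/(2d)) Σ_j (δ_{x−e_j} + δ_{x+e_j})` of the split
`f̂(k) = c + α D̂(k) + R̂(k)` ([NoBLE17] (1.8)). [cite: FitznerVanDerHofstad2016NoBLE, (1.8) (p. 1045); App. D (D.6)–(D.8) (pp. 1111–1112)] -/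
def nobleRem (f : Site d → ℝ) (c a : ℝ) (x : Site d) : ℝ := f x - c * nobleDelta x - a / (2 * d) * nobleNN x

/-- Auxiliary estimate / unfolding. [folklore] -/
theorem summable_abs_nobleRem {f : Site d → ℝ} (hf : Summable fun x => |f x|) (c a : ℝ) :
    Summable fun x => |nobleRem f c a x| := by
  unfold nobleRem
  refine summable_abs_add' (summable_abs_add' hf ?_) ?_
  · simpa [abs_mul, abs_neg] using summable_abs_nobleDelta.mul_left |c|
  · simpa [abs_mul, abs_neg, abs_div] using summable_abs_nobleNN.mul_left |a / (2 * d)|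

/-- `R̂(k) = f̂(k) − c − α D̂(k)`. [cite: FitznerVanDerHofstad2016NoBLE, (1.8) (p. 1045)] -/
theorem cosFT_nobleRem [NeZero d] {f : Site d → ℝ} (hf : Summable fun x => |f x|) (c a : ℝ) (k : Fin d → ℝ) :
    cosFT (nobleRem f c a) k = cosFT f k - c - a * Dhat d k := by
  have hd : (2 * d : ℝ) ≠ 0 := by
    have : (d : ℝ) ≠ 0 := by exact_mod_cast NeZero.ne d
    positivity
  rw [show nobleRem f c a = fun x => f x - c * nobleDelta x - a / (2 * d) * nobleNN x from rfl,
    cosFT_sub_sub hf summable_abs_nobleDelta summable_abs_nobleNN, cosFT_nobleDelta, cosFT_nobleNN]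
  rw [mul_one, div_mul_eq_mul_div, mul_comm a (2 * d * Dhat d k), show 2 * (d : ℝ) * Dhat d k * a / (2 * d) = a * Dhat d k by
    rw [mul_assoc, mul_comm (2 * (d : ℝ)), mul_div_assoc, div_self hd, mul_one, mul_comm]]

variable [NeZero d]

/-- **Assembly: [NoBLE17] Prop. 4.5(ii) / App. D for percolation, conditional on the App. D bounds.**
Given the `ℓ¹` hypotheses `NobleL1At`, the lace-expansion equation `(E)`, the symmetry constants
`ψ_p, π_p, ξ^ι_p` (Assumption 4.1 summed), the numerical side conditions `1 + ψ_p > 0`, `Σ|Ξ_p| + Σ|Ξ^ι_p| < 1`,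
and — as explicit hypotheses — the conclusions of App. D Steps 1, 2, 5 for candidate constants
`c_Φ, α_Φ, c_F, α_F` w.r.t. a bound tuple `B` (`(V) p ≤ β_μ μ_p`, `(D.2) 0 ≤ c_Φ ≤ c̄_Φ`, `(D.4) |α_Φ| ≤ β_{α,Φ}`,
`(D.3) α̲_F ≤ α_F`, `(D.5) π_p ≤ β_π, ψ_p ≥ −β_ψ`, `(D.14) Σ|R_Φ| ≤ β_{R,Φ}`, `(D.32) R̂_F(0) − R̂_F(k) ≥ −β_{ΔR,F}(1 − D̂(k))`),
the simplified rewrite `NobleSimplifiedFormAt d p B` holds: the identity `(I)` is the kernel-proved real form of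
`Ĝ(1 − F̂) = Φ̂` (§1.3/(4.35)), `(II)`/`(III)` and the signs of `λ_p` are Lemma 3.1.
[cite: FitznerVanDerHofstad2016NoBLE, Prop. 4.5(ii) (4.35) (p. 1087); (1.34) (p. 1050); Lemma 3.1 (pp. 1065–1066); App. D (D.6)–(D.8) (pp. 1111–1112)] -/
theorem nobleSimplifiedFormAt_of_bounds (h : NobleL1At d p P X) (hE : PercolationNobleEquationAt d p)
    (hμ0 : 0 < nobleMu d p) {ψ π ξι : ℝ}
    (hψ : ∀ ι, ∑' x, noblePsi d p ι x = ψ) (hπrow : ∀ ι, ∑ κ, ∑' x, noblePi d p ι κ x = π)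
    (hπcol : ∀ κ, ∑ ι, ∑' x, noblePi d p ι κ x = π) (hξι : ∀ ι, ∑' x, nobleXiIota d p ι x = ξι)
    (hψ1 : -1 < ψ) (hsmall : (∑' x, |nobleXi d p x|) + X < 1)
    (B : NobleBeta) {cΦ αΦ cF αF : ℝ}
    (hβμ : (p : ℝ) ≤ B.βμ * nobleMu d p) (hcΦ0 : 0 ≤ cΦ) (hcΦ : cΦ ≤ B.cΦup) (hαΦ : |αΦ| ≤ B.βαΦ)
    (hαF : B.αFlow ≤ αF) (hπB : π ≤ B.βPi) (hψB : -B.βΨ ≤ ψ)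
    (hRΦ : ∑' x, |nobleRem (noblePhi d p) cΦ αΦ x| ≤ B.βRΦ)
    (hΔ : ∀ k ∈ cube d, -(B.βΔ * (1 - Dhat d k)) ≤
      cosFT (nobleRem (nobleF d p) cF αF) 0 - cosFT (nobleRem (nobleF d p) cF αF) k) :
    NobleSimplifiedFormAt d p B := by
  obtain ⟨hlam0, hlamlt, hμeq, hFeq, -, -, -⟩ := noble_lemma31 h hE hμ0 hψ hπrow hπcol hξι hψ1 hsmall
  refine ⟨cΦ, αΦ, cF, αF, ψ, π, nobleLam d p ψ π, nobleRem (noblePhi d p) cΦ αΦ, nobleRem (nobleF d p) cF αF,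
    (summable_abs_nobleRem (summable_abs_noblePhi h) _ _).of_abs,
    (summable_abs_nobleRem (summable_abs_nobleF h) _ _).of_abs,
    ?_, hμeq, ?_, hlam0, hlamlt, hβμ, hcΦ0, hcΦ, hαΦ, hαF, hπB, hψB, hRΦ, hΔ⟩
  · intro k _
    rw [cosFT_nobleRem (summable_abs_nobleF h), cosFT_nobleRem (summable_abs_noblePhi h),
      ← noble_real_identity h hE k]
    ring
  · rw [cosFT_nobleRem (summable_abs_nobleF h), Dhat_zero, cosFT_zero, hFeq]
    ring

end Assembly

/-! ## H. Discharging the hypotheses from Assumptions 4.1–4.3 for percolation (`d ≥ 2`, `0 < p < p_c`) -/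

section Discharge

local notation "𝐞" => Literature.Probability.Percolation.stepVec

variable {p : unitInterval}

/-- From an `NSumLE` bound with `F_N ≥ 0`: `x ↦ Σ_N F_N(x)` is summable and `Σ_x Σ_N F_N(x) = Σ_N Σ_x F_N(x) ≤ β`
(Tonelli). [folklore] -/
theorem l1_of_NSumLE {F : ℕ → Site d → ℝ} (h0 : ∀ N x, 0 ≤ F N x) {β : ℝ} (hF : NSumLE F β) :
    (∀ x, Summable fun N => F N x) ∧ (Summable fun x => ∑' N, F N x) ∧
    (∑' x, ∑' N, F N x = ∑' N, ∑' x, F N x) ∧ (∑' x, ∑' N, F N x ≤ β) := by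
  obtain ⟨h1, h2, h3⟩ := hF
  obtain ⟨hN, hx⟩ := summable_swap_of_nonneg h0 h1 h2
  have hprod : Summable (Function.uncurry F) := (summable_prod_of_nonneg fun q => h0 q.1 q.2).2 ⟨h1, h2⟩
  have hcomm : ∑' x, ∑' N, F N x = ∑' N, ∑' x, F N x := hprod.tsum_comm
  exact ⟨hN, hx, hcomm, hcomm ▸ h3⟩

/-- `ℓ¹` and the `x`-sum of an alternating `N`-series `Σ_N (−1)^N F_N(x)` with `F_N ≥ 0`, from an `NSumLE` bound:
`Σ_x |Σ_N (−1)^N F_N(x)| ≤ Σ_N Σ_x F_N(x) ≤ β` and `Σ_x Σ_N (−1)^N F_N(x) = Σ_N (−1)^N Σ_x F_N(x)` (Fubini).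
[folklore] -/
theorem alternating_of_NSumLE {F : ℕ → Site d → ℝ} (h0 : ∀ N x, 0 ≤ F N x) {β : ℝ} (hF : NSumLE F β) :
    (Summable fun x => |∑' N, (-1 : ℝ) ^ N * F N x|) ∧
    (∑' x, |∑' N, (-1 : ℝ) ^ N * F N x| ≤ β) ∧
    (Summable fun N => (-1 : ℝ) ^ N * ∑' x, F N x) ∧
    (∑' x, ∑' N, (-1 : ℝ) ^ N * F N x = ∑' N, (-1 : ℝ) ^ N * ∑' x, F N x) := by
  obtain ⟨hN, hx, hcomm, hle⟩ := l1_of_NSumLE h0 hF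
  obtain ⟨h1, h2, h3⟩ := hF
  have hprod : Summable (Function.uncurry F) := (summable_prod_of_nonneg fun q => h0 q.1 q.2).2 ⟨h1, h2⟩
  have habs : ∀ x, |∑' N, (-1 : ℝ) ^ N * F N x| ≤ ∑' N, F N x :=
    fun x => abs_alternating_tsum_le (hN x) (fun N => h0 N x)
  have hs : Summable fun x => |∑' N, (-1 : ℝ) ^ N * F N x| :=
    Summable.of_nonneg_of_le (fun _ => abs_nonneg _) habs hx
  have hsg : Summable (Function.uncurry fun N x => (-1 : ℝ) ^ N * F N x) :=
    Summable.of_norm_bounded hprod (fun q => by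
      obtain ⟨N, x⟩ := q
      simp [Function.uncurry, abs_of_nonneg (h0 N x)])
  refine ⟨hs, (hs.tsum_le_tsum habs hx).trans hle, ?_, ?_⟩
  · exact Summable.of_norm_bounded h2 (fun N => by
      rw [norm_mul, norm_pow, norm_neg, norm_one, one_pow, one_mul, Real.norm_eq_abs,
        abs_of_nonneg (tsum_nonneg fun x => h0 N x)])
  · rw [hsg.tsum_comm]
    exact tsum_congr fun N => tsum_mul_left

/-- An `NSumLE` bound for a dominated non-negative family: `G_N ≤ c F_N`, `NSumLE F β` give `NSumLE G (cβ)`. [folklore] -/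
theorem NSumLE_of_le {F G : ℕ → Site d → ℝ} (hG0 : ∀ N x, 0 ≤ G N x) {c : ℝ} (hc : 0 ≤ c)
    (hle : ∀ N x, G N x ≤ c * F N x) {β : ℝ} (hF : NSumLE F β) : NSumLE G (c * β) := by
  obtain ⟨h1, h2, h3⟩ := hF
  have hG : ∀ N, Summable (G N) := fun N => Summable.of_nonneg_of_le (hG0 N) (hle N) ((h1 N).mul_left c)
  have hGle : ∀ N, ∑' x, G N x ≤ c * ∑' x, F N x := fun N => by
    rw [← tsum_mul_left]; exact (hG N).tsum_le_tsum (hle N) ((h1 N).mul_left c)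
  have hGN : Summable fun N => ∑' x, G N x :=
    Summable.of_nonneg_of_le (fun N => tsum_nonneg (hG0 N)) hGle (h2.mul_left c)
  refine ⟨hG, hGN, ?_⟩
  calc ∑' N, ∑' x, G N x ≤ ∑' N, c * ∑' x, F N x := hGN.tsum_le_tsum hGle (h2.mul_left c)
    _ = c * ∑' N, ∑' x, F N x := tsum_mul_left
    _ ≤ c * β := mul_le_mul_of_nonneg_left h3 hc

/-- The bound of an `NSumLE` of a non-negative family is non-negative. [folklore] -/
theorem NSumLE_nonneg {F : ℕ → Site d → ℝ} (h0 : ∀ N x, 0 ≤ F N x) {β : ℝ} (hF : NSumLE F β) : 0 ≤ β :=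
  (tsum_nonneg fun N => tsum_nonneg (h0 N)).trans hF.2.2

/-- `Σ_N (−1)^N a_N = Σ_m a_{2m} − Σ_m a_{2m+1}` when both halves converge. [folklore] -/
theorem tsum_alternating_eq_even_sub_odd {a : ℕ → ℝ} (he : Summable fun m => a (2 * m))
    (ho : Summable fun m => a (2 * m + 1)) :
    ∑' N, (-1 : ℝ) ^ N * a N = ∑' m, a (2 * m) - ∑' m, a (2 * m + 1) := by
  have h1 : ∀ m, (-1 : ℝ) ^ (2 * m) * a (2 * m) = a (2 * m) := fun m => by
    rw [pow_mul, neg_one_sq, one_pow, one_mul]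
  have h2 : ∀ m, (-1 : ℝ) ^ (2 * m + 1) * a (2 * m + 1) = -a (2 * m + 1) := fun m => by
    rw [pow_succ, pow_mul, neg_one_sq, one_pow, one_mul, neg_one_mul]
  have h := tsum_even_add_odd (f := fun N => (-1 : ℝ) ^ N * a N) (by simp_rw [h1]; exact he)
    (by simp_rw [h2]; exact ho.neg)
  simp_rw [h1, h2, tsum_neg] at h
  linarith

variable (hd : 2 ≤ d) (hp : p < criticalProbI d)
include hd hp

/-- `NSumLE` for `Ψ^{(M_N),κ}` from the one for `Ξ^{(M_N)}` ((4.29): `Ψ^{(N),κ} ≤ (μ̄/μ) Ξ^{(N)}`), along any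
reindexing `N ↦ M_N` (all / even / odd levels). [cite: FitznerVanDerHofstad2016NoBLE, (4.29) (p. 1086)] -/
theorem NSumLE_noblePsiN {β : ℝ} {M : ℕ → ℕ} (hΞ : NSumLE (fun N x => nobleXiN d p (M N) x) β) (κ : Fin d × Bool) :
    NSumLE (fun N x => noblePsiN d p (𝐞 κ) (M N) x) ((p : ℝ) / nobleMu d p * β) :=
  NSumLE_of_le (fun _ x => noblePsiN_nonneg' p _ _ x)
    (div_nonneg p.2.1 (nobleMu_nonneg d p)) (fun N x => noblePsiN_le_mul_nobleXiN hd hp κ (M N) x) hΞ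

/-- `NSumLE` for `Π^{(M_N),ι,κ}` from the one for `Ξ^{(M_N),ι}` ((4.29): `Π^{(N),ι,κ} ≤ μ̄ Ξ^{(N),ι}`). [cite: FitznerVanDerHofstad2016NoBLE, (4.29) (p. 1086)] -/
theorem NSumLE_noblePiN {β : ℝ} (ι : Fin d × Bool) {M : ℕ → ℕ}
    (hΞ : NSumLE (fun N x => nobleXiIotaN d p (𝐞 ι) (M N) x) β) (κ : Fin d × Bool) :
    NSumLE (fun N x => noblePiN d p (𝐞 ι) (𝐞 κ) (M N) x) ((p : ℝ) * β) :=
  NSumLE_of_le (fun _ x => noblePiN_nonneg p _ _ _ x) p.2.1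
    (fun N x => noblePiN_le_mul_nobleXiIotaN hd hp _ _ (M N) x) hΞ

omit hp in
/-- `NSumLE` for the `κ`-SUMMED `Σ_κ Π^{(M_N),ι,κ}` with the non-backtracking factor `(2d−1)μ̄`
(`NobleRelationSummedAt`, a tree theorem below `p_c`), along any reindexing `N ↦ M_N`.
[cite: FitznerVanDerHofstad2016NoBLE, (4.29) (p. 1086); App. D (D.5), (D.11) (pp. 1111–1113)] -/
theorem NSumLE_sum_noblePiN (hRel : NobleRelationSummedAt d p) {β : ℝ} (ι : Fin d × Bool) {M : ℕ → ℕ}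
    (hΞ : NSumLE (fun N x => nobleXiIotaN d p (𝐞 ι) (M N) x) β) :
    NSumLE (fun N x => ∑ κ, noblePiN d p (𝐞 ι) (𝐞 κ) (M N) x) ((2 * d - 1) * (p : ℝ) * β) := by
  have hd1 : (0 : ℝ) ≤ 2 * d - 1 := by
    have : (2 : ℝ) ≤ d := by exact_mod_cast hd
    linarith
  exact NSumLE_of_le (fun N x => Finset.sum_nonneg fun κ _ => noblePiN_nonneg p _ _ _ x) (mul_nonneg hd1 p.2.1)
    (fun N x => hRel.2 (M N) ι x) hΞ

omit hp in
/-- `NSumLE` for the `κ`-SUMMED `Σ_κ Ψ^{(M_N),κ}` with the factor `(2d−1)μ̄/μ`. [cite: FitznerVanDerHofstad2016NoBLE, (4.29) (p. 1086); App. D (D.5) (p. 1111)] -/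
theorem NSumLE_sum_noblePsiN (hRel : NobleRelationSummedAt d p) {β : ℝ} {M : ℕ → ℕ}
    (hΞ : NSumLE (fun N x => nobleXiN d p (M N) x) β) :
    NSumLE (fun N x => ∑ κ, noblePsiN d p (𝐞 κ) (M N) x) ((2 * d - 1) * ((p : ℝ) / nobleMu d p) * β) := by
  have hd1 : (0 : ℝ) ≤ 2 * d - 1 := by
    have : (2 : ℝ) ≤ d := by exact_mod_cast hd
    linarith
  exact NSumLE_of_le (fun N x => Finset.sum_nonneg fun κ _ => noblePsiN_nonneg' p _ _ x)
    (mul_nonneg hd1 (div_nonneg p.2.1 (nobleMu_nonneg d p))) (fun N x => hRel.1 (M N) x) hΞ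

variable {i : BetaMap.Inputs} {S : NobleSplit d p}

/-- **Assumption 4.1 (4.28) summed over `N`: `Ψ̂^ι_p(0) = Ψ̂^κ_p(0)`.** [cite: FitznerVanDerHofstad2016NoBLE, Assumption 4.1 (4.28) (p. 1085); Lemma 3.1 proof (p. 1066)] -/
theorem noble_tsum_psi_eq (h41 : NobleAssumption41At d p S) (h43 : NobleAssumption43At d p S i) (ι κ : Fin d × Bool) :
    ∑' x, noblePsi d p ι x = ∑' x, noblePsi d p κ x := by
  have e := fun (η : Fin d × Bool) => (alternating_of_NSumLE (fun N x => noblePsiN_nonneg' p (𝐞 η) N x)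
    (NSumLE_noblePsiN hd hp (M := id) h43.xiAbs η)).2.2.2
  show (∑' x, ∑' N, (-1 : ℝ) ^ N * noblePsiN d p (𝐞 ι) N x) = ∑' x, ∑' N, (-1 : ℝ) ^ N * noblePsiN d p (𝐞 κ) N x
  rw [e ι, e κ]
  exact tsum_congr fun N => by rw [h41.psi_exch N ι κ]

omit hd hp in
/-- **Assumption 4.1 (4.28) summed over `N`: `Ξ̂^ι_p(0) = Ξ̂^κ_p(0)`.** [cite: FitznerVanDerHofstad2016NoBLE, Assumption 4.1 (4.28) (p. 1085)] -/
theorem noble_tsum_xiIota_eq (h41 : NobleAssumption41At d p S) (h43 : NobleAssumption43At d p S i) (ι κ : Fin d × Bool) :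
    ∑' x, nobleXiIota d p ι x = ∑' x, nobleXiIota d p κ x := by
  have e := fun (η : Fin d × Bool) => (alternating_of_NSumLE (fun N x => nobleXiIotaN_nonneg p (𝐞 η) N x)
    (h43.xiIotaAbs η)).2.2.2
  show (∑' x, ∑' N, (-1 : ℝ) ^ N * nobleXiIotaN d p (𝐞 ι) N x) = ∑' x, ∑' N, (-1 : ℝ) ^ N * nobleXiIotaN d p (𝐞 κ) N x
  rw [e ι, e κ]
  exact tsum_congr fun N => by rw [h41.xiIota_exch N ι κ]

/-- Row sums of `Π̂_p(0)` as an alternating `N`-series. [cite: FitznerVanDerHofstad2016NoBLE, (4.2) (p. 1080), (D.5) (p. 1111)] -/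
theorem noble_pi_row_eq (h43 : NobleAssumption43At d p S i) (ι : Fin d × Bool) :
    (∀ κ, Summable fun N => (-1 : ℝ) ^ N * ∑' x, noblePiN d p (𝐞 ι) (𝐞 κ) N x) ∧
    ∑ κ, ∑' x, noblePi d p ι κ x = ∑' N, (-1 : ℝ) ^ N * ∑ κ, ∑' x, noblePiN d p (𝐞 ι) (𝐞 κ) N x := by
  have A := fun κ => alternating_of_NSumLE (fun N x => noblePiN_nonneg p (𝐞 ι) (𝐞 κ) N x)
    (NSumLE_noblePiN hd hp ι (M := id) (h43.xiIotaAbs ι) κ)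
  refine ⟨fun κ => (A κ).2.2.1, ?_⟩
  have e : ∀ κ, ∑' x, noblePi d p ι κ x = ∑' N, (-1 : ℝ) ^ N * ∑' x, noblePiN d p (𝐞 ι) (𝐞 κ) N x :=
    fun κ => (A κ).2.2.2
  simp_rw [e]
  rw [← Summable.tsum_finsetSum (fun κ _ => (A κ).2.2.1)]
  exact tsum_congr fun N => by rw [Finset.mul_sum]

/-- Column sums of `Π̂_p(0)` as an alternating `N`-series. [cite: FitznerVanDerHofstad2016NoBLE, (4.2) (p. 1080)] -/
theorem noble_pi_col_eq (h43 : NobleAssumption43At d p S i) (κ : Fin d × Bool) :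
    ∑ ι, ∑' x, noblePi d p ι κ x = ∑' N, (-1 : ℝ) ^ N * ∑ ι, ∑' x, noblePiN d p (𝐞 ι) (𝐞 κ) N x := by
  have A := fun ι => alternating_of_NSumLE (fun N x => noblePiN_nonneg p (𝐞 ι) (𝐞 κ) N x)
    (NSumLE_noblePiN hd hp ι (M := id) (h43.xiIotaAbs ι) κ)
  have e : ∀ ι, ∑' x, noblePi d p ι κ x = ∑' N, (-1 : ℝ) ^ N * ∑' x, noblePiN d p (𝐞 ι) (𝐞 κ) N x :=
    fun ι => (A ι).2.2.2
  simp_rw [e]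
  rw [← Summable.tsum_finsetSum (fun ι _ => (A ι).2.2.1)]
  exact tsum_congr fun N => by rw [Finset.mul_sum]

/-- **Assumption 4.1 (4.28) summed over `N`: all row sums and all column sums of `Π̂_p(0)` coincide** (`= π_p`).
[cite: FitznerVanDerHofstad2016NoBLE, Assumption 4.1 (4.28) (p. 1085); Lemma 3.1 proof (p. 1066)] -/
theorem noble_pi_rowcol (h41 : NobleAssumption41At d p S) (h43 : NobleAssumption43At d p S i) (ι₀ : Fin d × Bool) :
    (∀ ι, ∑ κ, ∑' x, noblePi d p ι κ x = ∑ κ, ∑' x, noblePi d p ι₀ κ x) ∧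
    (∀ κ, ∑ ι, ∑' x, noblePi d p ι κ x = ∑ κ, ∑' x, noblePi d p ι₀ κ x) := by
  refine ⟨fun ι => ?_, fun κ => ?_⟩
  · rw [(noble_pi_row_eq hd hp h43 ι).2, (noble_pi_row_eq hd hp h43 ι₀).2]
    exact tsum_congr fun N => by rw [h41.pi_exch N ι ι₀, ← h41.pi_exch N ι₀ ι₀]
  · rw [noble_pi_col_eq hd hp h43 κ, (noble_pi_row_eq hd hp h43 ι₀).2]
    exact tsum_congr fun N => by rw [h41.pi_exch N ι₀ κ]

/-- **The `ℓ¹` hypotheses from Assumption 4.3 at `p`** (`0 < p < p_c`): `X = β^abs_{Ξ^ι}`, `P = (2d−1) μ̄ β^abs_{Ξ^ι}`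
(App. D Step 2 "`P = Σ_κ ‖Π^{ι,κ}‖₁ ≤ (2d−1) μ̄ β_{Ξ^ι}`", (4.34) for `P < 1 − μ`).
[cite: FitznerVanDerHofstad2016NoBLE, (4.29)–(4.34) (pp. 1086–1087); App. D (D.9)–(D.12) (pp. 1112–1113)] -/
theorem nobleL1At_of_assumption43 (hp0 : 0 < (p : ℝ)) (h43 : NobleAssumption43At d p S i) :
    NobleL1At d p ((2 * d - 1) * (p : ℝ) * i.xiIotaAbs) i.xiIotaAbs := by
  have hRel := nobleRelationSummedAt_of_lt_criticalProbI hd hp0 hp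
  have hp1 : (p : ℝ) < 1 := lt_of_lt_of_le (show (p : ℝ) < (criticalProbI d : ℝ) by exact_mod_cast hp) (criticalProbI d).2.2
  have hμ1 : nobleMu d p < 1 := (nobleMu_le_coe p).trans_lt hp1
  refine
    { mu_lt_one := hμ1
      tau := summable_tau_of_lt_criticalProb hd p (coe_lt_criticalProb_of_lt hp)
      xi := (alternating_of_NSumLE (fun N x => nobleXiN_nonneg p N x) h43.xiAbs).1
      psi := fun κ => (alternating_of_NSumLE (fun N x => noblePsiN_nonneg' p _ N x)
        (NSumLE_noblePsiN hd hp (M := id) h43.xiAbs κ)).1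
      xiIota := fun ι => (alternating_of_NSumLE (fun N x => nobleXiIotaN_nonneg p _ N x) (h43.xiIotaAbs ι)).1
      pi := fun ι κ => (alternating_of_NSumLE (fun N x => noblePiN_nonneg p _ _ N x)
        (NSumLE_noblePiN hd hp ι (M := id) (h43.xiIotaAbs ι) κ)).1
      xiIota_le := fun ι => (alternating_of_NSumLE (fun N x => nobleXiIotaN_nonneg p _ N x) (h43.xiIotaAbs ι)).2.1
      pi_le := fun ι => ?_
      P_lt := ?_ }
  · -- `Σ_κ ‖Π^{ι,κ}‖₁ ≤ Σ_x Σ_N Σ_κ Π^{(N),ι,κ}(x) ≤ (2d−1) μ̄ β^abs_{Ξ^ι}`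
    have A := fun κ => alternating_of_NSumLE (fun N x => noblePiN_nonneg p (𝐞 ι) (𝐞 κ) N x)
      (NSumLE_noblePiN hd hp ι (M := id) (h43.xiIotaAbs ι) κ)
    have L := fun κ => l1_of_NSumLE (fun N x => noblePiN_nonneg p (𝐞 ι) (𝐞 κ) N x)
      (NSumLE_noblePiN hd hp ι (M := id) (h43.xiIotaAbs ι) κ)
    obtain ⟨-, GS, -, Gle⟩ := l1_of_NSumLE (fun N x => Finset.sum_nonneg fun κ _ => noblePiN_nonneg p (𝐞 ι) (𝐞 κ) N x)
      (NSumLE_sum_noblePiN hd hRel ι (M := id) (h43.xiIotaAbs ι))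
    have step1 : ∀ κ, ∑' x, |noblePi d p ι κ x| ≤ ∑' x, ∑' N, noblePiN d p (𝐞 ι) (𝐞 κ) N x := fun κ =>
      (A κ).1.tsum_le_tsum (fun x => abs_alternating_tsum_le ((L κ).1 x) (fun N => noblePiN_nonneg p _ _ N x)) (L κ).2.1
    refine (Finset.sum_le_sum fun κ _ => step1 κ).trans ?_
    rw [← Summable.tsum_finsetSum (fun κ _ => (L κ).2.1)]
    refine le_trans (le_of_eq (tsum_congr fun x => ?_)) Gle
    exact (Summable.tsum_finsetSum (fun κ _ => (L κ).1 x)).symm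
  · have h1μ : 0 < 1 - nobleMu d p := by linarith
    have := h43.geom_lt_one
    rw [div_mul_eq_mul_div, div_lt_one h1μ] at this
    exact this

/-- **(D.5), lower bound on `Ψ̂_p(0)`:** `ψ_p ≥ β̲^{(0)}_Ψ − ((2d−1)/(2d)) (μ̄/μ) Σ_N β^{(2N+1)}_Ξ = −β_Ψ` (hybrid
conversion factor, HOME/DIVERGENCE.md D29: the per-`κ` value `Ψ̂^{(N),κ}(0)` is `1/(2d)` of the `κ`-sum by (4.28)).
[cite: FitznerVanDerHofstad2016NoBLE, App. D (D.5) (p. 1111); (4.28), (4.35) (pp. 1085–1087)] -/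
theorem noble_psi_lower (hp0 : 0 < (p : ℝ)) (h41 : NobleAssumption41At d p S) (h43 : NobleAssumption43At d p S i)
    (κ : Fin d × Bool) :
    -(BetaMap.nobleBetaOfInputs d i).βΨ ≤ ∑' x, noblePsi d p κ x := by
  have hRel := nobleRelationSummedAt_of_lt_criticalProbI hd hp0 hp
  have hp1 : (p : ℝ) < 1 := lt_of_lt_of_le (show (p : ℝ) < (criticalProbI d : ℝ) by exact_mod_cast hp) (criticalProbI d).2.2
  have hμ0 : 0 < nobleMu d p := nobleMu_pos (by omega) hp0 hp1
  have hdpos : (0 : ℝ) < 2 * d := by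
    have : (2 : ℝ) ≤ d := by exact_mod_cast hd
    linarith
  have hcard : (Fintype.card (Fin d × Bool) : ℝ) = 2 * d := by
    rw [Fintype.card_prod, Fintype.card_fin, Fintype.card_bool]; push_cast; ring
  set a : ℕ → ℝ := fun N => ∑' x, noblePsiN d p (𝐞 κ) N x with ha
  have ha0 : ∀ N, 0 ≤ a N := fun N => tsum_nonneg fun x => noblePsiN_nonneg' p _ N x
  -- `ψ = Σ_N (−1)^N a_N`
  obtain ⟨-, -, hsum, hrep⟩ := alternating_of_NSumLE (fun N x => noblePsiN_nonneg' p (𝐞 κ) N x)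
    (NSumLE_noblePsiN hd hp (M := id) h43.xiAbs κ)
  have hψ : ∑' x, noblePsi d p κ x = ∑' N, (-1 : ℝ) ^ N * a N := hrep
  -- even / odd parts
  have he : Summable fun m => a (2 * m) :=
    (NSumLE_noblePsiN hd hp (M := fun m => 2 * m) h43.xiEven κ).2.1
  have hodd := NSumLE_sum_noblePsiN hd hRel (M := fun m => 2 * m + 1) h43.xiOdd
  have ho' : Summable fun m => a (2 * m + 1) :=
    (NSumLE_noblePsiN hd hp (M := fun m => 2 * m + 1) h43.xiOdd κ).2.1
  have hsplit : ∑' N, (-1 : ℝ) ^ N * a N = ∑' m, a (2 * m) - ∑' m, a (2 * m + 1) :=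
    tsum_alternating_eq_even_sub_odd he ho'
  -- `a_0 ≥ β̲_Ψ`
  have h0 : i.psiZeroLower ≤ a 0 := (h43.psiZeroLower κ).2
  have heven : a 0 ≤ ∑' m, a (2 * m) := he.le_tsum 0 (fun m _ => ha0 _)
  -- `2d a_{2m+1} = Σ_κ' a_{2m+1}(κ') = Σ_x Σ_κ' Ψ^{(2m+1),κ'}(x)`
  have hκ : ∀ N, 2 * d * a N = ∑' x, ∑ κ', noblePsiN d p (𝐞 κ') N x := fun N => by
    rw [Summable.tsum_finsetSum (fun κ' _ => summable_noblePsiN hd hp _ N), Finset.sum_congr rfl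
      fun κ' _ => h41.psi_exch N κ' κ, Finset.sum_const, Finset.card_univ, nsmul_eq_mul, hcard]
  have hoddle : ∑' m, a (2 * m + 1) ≤ (2 * d - 1) / (2 * d) * ((p : ℝ) / nobleMu d p) * i.xiOdd := by
    have e : ∀ m, a (2 * m + 1) = (2 * d : ℝ)⁻¹ * ∑' x, ∑ κ', noblePsiN d p (𝐞 κ') (2 * m + 1) x := fun m => by
      rw [← hκ, ← mul_assoc, inv_mul_cancel₀ hdpos.ne', one_mul]
    simp_rw [e]
    rw [tsum_mul_left]
    have := hodd.2.2
    calc (2 * d : ℝ)⁻¹ * ∑' m, ∑' x, ∑ κ', noblePsiN d p (𝐞 κ') (2 * m + 1) x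
        ≤ (2 * d : ℝ)⁻¹ * ((2 * d - 1) * ((p : ℝ) / nobleMu d p) * i.xiOdd) :=
          mul_le_mul_of_nonneg_left this (inv_nonneg.2 hdpos.le)
      _ = _ := by field_simp
  -- `p/μ ≤ β_μ`, `β^odd_Ξ ≥ 0`
  have hpm : (p : ℝ) / nobleMu d p ≤ i.mubOverMu := by
    rw [div_le_iff₀ hμ0]; exact h43.mubOverMu
  have hxo : 0 ≤ i.xiOdd := NSumLE_nonneg (fun N x => nobleXiN_nonneg p _ x) h43.xiOdd
  have hd1 : (0 : ℝ) ≤ (2 * d - 1) / (2 * d) := by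
    apply div_nonneg _ hdpos.le
    have : (2 : ℝ) ≤ d := by exact_mod_cast hd
    linarith
  have hmono : (2 * d - 1) / (2 * d) * ((p : ℝ) / nobleMu d p) * i.xiOdd ≤ (2 * d - 1) / (2 * d) * i.mubOverMu * i.xiOdd :=
    mul_le_mul_of_nonneg_right (mul_le_mul_of_nonneg_left hpm hd1) hxo
  have hβ : (BetaMap.nobleBetaOfInputs d i).βΨ = (2 * d - 1) / (2 * d) * i.mubOverMu * i.xiOdd - i.psiZeroLower := by
    simp [BetaMap.nobleBetaOfInputs, BetaMap.betaPsiHatLower]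
  rw [hβ, hψ, hsplit]
  linarith

/-- **(D.5), upper bound on the row sums of `Π̂_p(0)`:** `π_p ≤ (2d−1) μ̄ Σ_N β^{(2N)}_{Ξ^ι} − β̲^{(1)}_{ΣΠ} = β_π`
(hybrid conversion factor `(2d−1)μ̄`, HOME/DIVERGENCE.md D29/D43).
[cite: FitznerVanDerHofstad2016NoBLE, App. D (D.5) (p. 1111); (4.29), (4.35) (pp. 1086–1087)] -/
theorem noble_pi_upper (hp0 : 0 < (p : ℝ)) (h43 : NobleAssumption43At d p S i) (ι : Fin d × Bool) :
    ∑ κ, ∑' x, noblePi d p ι κ x ≤ (BetaMap.nobleBetaOfInputs d i).βPi := by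
  have hRel := nobleRelationSummedAt_of_lt_criticalProbI hd hp0 hp
  have hdpos : (0 : ℝ) < 2 * d := by
    have : (2 : ℝ) ≤ d := by exact_mod_cast hd
    linarith
  set r : ℕ → ℝ := fun N => ∑ κ, ∑' x, noblePiN d p (𝐞 ι) (𝐞 κ) N x with hr
  have hr0 : ∀ N, 0 ≤ r N := fun N => Finset.sum_nonneg fun κ _ => tsum_nonneg fun x => noblePiN_nonneg p _ _ N x
  have hr' : ∀ N, r N = ∑' x, ∑ κ, noblePiN d p (𝐞 ι) (𝐞 κ) N x := fun N =>
    (Summable.tsum_finsetSum (fun κ _ => summable_noblePiN hd hp _ _ N)).symm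
  obtain ⟨-, hπ⟩ := noble_pi_row_eq hd hp h43 ι
  have hEv := NSumLE_sum_noblePiN hd hRel ι (M := fun m => 2 * m) (h43.xiIotaEven ι)
  have hOd := NSumLE_sum_noblePiN hd hRel ι (M := fun m => 2 * m + 1) (h43.xiIotaOdd ι)
  have he : Summable fun m => r (2 * m) := by simp_rw [hr']; exact hEv.2.1
  have ho : Summable fun m => r (2 * m + 1) := by simp_rw [hr']; exact hOd.2.1
  have hsplit : ∑' N, (-1 : ℝ) ^ N * r N = ∑' m, r (2 * m) - ∑' m, r (2 * m + 1) :=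
    tsum_alternating_eq_even_sub_odd he ho
  have h1 : i.piOneLower ≤ r 1 := (h43.piOneLower ι).2
  have hodd1 : r 1 ≤ ∑' m, r (2 * m + 1) := ho.le_tsum 0 (fun m _ => hr0 _)
  have hevle : ∑' m, r (2 * m) ≤ (2 * d - 1) * (p : ℝ) * i.xiIotaEven := by
    simp_rw [hr']; exact hEv.2.2
  have hxe : 0 ≤ i.xiIotaEven := NSumLE_nonneg (fun N x => nobleXiIotaN_nonneg p _ _ x) (h43.xiIotaEven ι)
  have hd1 : (0 : ℝ) ≤ 2 * d - 1 := by
    have : (2 : ℝ) ≤ d := by exact_mod_cast hd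
    linarith
  have hmono : (2 * d - 1) * (p : ℝ) * i.xiIotaEven ≤ (2 * d - 1) * i.mub * i.xiIotaEven :=
    mul_le_mul_of_nonneg_right (mul_le_mul_of_nonneg_left h43.mub_le hd1) hxe
  have hβ : (BetaMap.nobleBetaOfInputs d i).βPi = (2 * d - 1) * i.mub * i.xiIotaEven - i.piOneLower := by
    show BetaMap.betaPiHat d ((2 * d - 1) / (2 * d) * i.mub) i.xiIotaEven i.piOneLower = _
    unfold BetaMap.betaPiHat
    rw [show (2 * d : ℝ) * ((2 * d - 1) / (2 * d) * i.mub) = (2 * d - 1) * i.mub by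
      rw [← mul_assoc, mul_div_cancel₀ _ hdpos.ne']]
  rw [hβ, hπ, hsplit]
  linarith

/-- **[NoBLE17] Prop. 4.5(ii) / App. D for percolation — kernel form, conditional on App. D Steps 1, 2, 5.**
For `d ≥ 2`, `0 < p < p_c`, constants `i` and a split `S` with Assumptions 4.1 and 4.3 at `p`
(`NobleAssumption41At`, `NobleAssumption43At`; Assumption 4.2 and the `κ`-summed relations are tree theorems
below `p_c`), the `x`-space NoBLE equations (`PercolationNobleEquationAt`), the two NUMERICAL side conditions
`β^abs_Ξ + β^abs_{Ξ^ι} < 1` and `β_Ψ < 1` (these make `Φ̂_p(0) > 0`, `F̂_p(0) < 1`, `1 + ψ_p > 0`, whence the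
signs `λ_p ≥ 0`, `(2d−1)λ_p < 1` of Lemma 3.1 — the print takes them from Assumption 2.7's positivity clause),
and candidate constants `c_Φ, α_Φ, c_F, α_F` obeying the CONCLUSIONS of App. D Step 1 ((D.2)–(D.4): `0 ≤ c_Φ ≤ c̄_Φ`,
`|α_Φ| ≤ β_{α,Φ}`, `α_F ≥ α̲_F`), Step 2 ((D.14): `Σ|R_Φ| ≤ β_{R,Φ}`) and Step 5 ((D.32)), the simplified rewrite
`NobleSimplifiedFormAt d p (nobleBetaOfInputs d i)` HOLDS — with `(I)` the kernel-proved `τ̂(1 − F̂) = Φ̂`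
(§1.3/(4.35)), `(II)`/`(III)`/signs = Lemma 3.1, `(V)` = (4.30), and the `π_p`, `ψ_p` bounds = (D.5), all
kernel-proved here.  This removes the `k`-space rewrite, Lemma 3.1 and (D.5) from the uncited leaf
`FitznerVanDerHofstad2016NoBLE_prop45ii`; what remains of that leaf is exactly App. D Steps 1, 2, 5.
[cite: FitznerVanDerHofstad2016NoBLE, Prop. 4.5(ii) (4.35) (p. 1087); Lemma 3.1 (pp. 1065–1066); App. D (D.1)–(D.8) (pp. 1110–1112)] -/
theorem nobleSimplifiedFormAt_of_assumptions (hp0 : 0 < (p : ℝ)) (hE : PercolationNobleEquationAt d p)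
    (h41 : NobleAssumption41At d p S) (h43 : NobleAssumption43At d p S i)
    (hN2 : i.xiAbs + i.xiIotaAbs < 1) (hN3 : (BetaMap.nobleBetaOfInputs d i).βΨ < 1)
    {cΦ αΦ cF αF : ℝ}
    (hcΦ0 : 0 ≤ cΦ) (hcΦ : cΦ ≤ (BetaMap.nobleBetaOfInputs d i).cΦup)
    (hαΦ : |αΦ| ≤ (BetaMap.nobleBetaOfInputs d i).βαΦ) (hαF : (BetaMap.nobleBetaOfInputs d i).αFlow ≤ αF)
    (hRΦ : ∑' x, |nobleRem (noblePhi d p) cΦ αΦ x| ≤ (BetaMap.nobleBetaOfInputs d i).βRΦ)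
    (hΔ : ∀ k ∈ cube d, -((BetaMap.nobleBetaOfInputs d i).βΔ * (1 - Dhat d k)) ≤
      cosFT (nobleRem (nobleF d p) cF αF) 0 - cosFT (nobleRem (nobleF d p) cF αF) k) :
    NobleSimplifiedFormAt d p (BetaMap.nobleBetaOfInputs d i) := by
  haveI : NeZero d := ⟨by omega⟩
  have hp1 : (p : ℝ) < 1 := lt_of_lt_of_le (show (p : ℝ) < (criticalProbI d : ℝ) by exact_mod_cast hp) (criticalProbI d).2.2
  have hμ0 : 0 < nobleMu d p := nobleMu_pos (by omega) hp0 hp1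
  have hL1 := nobleL1At_of_assumption43 hd hp hp0 h43
  set ι₀ : Fin d × Bool := (⟨0, by omega⟩, true)
  obtain ⟨hrow, hcol⟩ := noble_pi_rowcol hd hp h41 h43 ι₀
  have hψ : ∀ ι, ∑' x, noblePsi d p ι x = ∑' x, noblePsi d p ι₀ x := fun ι => noble_tsum_psi_eq hd hp h41 h43 ι ι₀
  have hξι : ∀ ι, ∑' x, nobleXiIota d p ι x = ∑' x, nobleXiIota d p ι₀ x :=
    fun ι => noble_tsum_xiIota_eq h41 h43 ι ι₀
  have hψB := noble_psi_lower hd hp hp0 h41 h43 ι₀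
  have hπB := noble_pi_upper hd hp hp0 h43 ι₀
  have hψ1 : -1 < ∑' x, noblePsi d p ι₀ x := by linarith
  have hΞ : (∑' x, |nobleXi d p x|) ≤ i.xiAbs := (alternating_of_NSumLE (fun N x => nobleXiN_nonneg p N x) h43.xiAbs).2.1
  have hsmall : (∑' x, |nobleXi d p x|) + i.xiIotaAbs < 1 := by linarith
  have hβμ : (p : ℝ) ≤ (BetaMap.nobleBetaOfInputs d i).βμ * nobleMu d p := h43.mubOverMu
  exact nobleSimplifiedFormAt_of_bounds hL1 hE hμ0 hψ hrow hcol hξι hψ1 hsmall _ hβμ hcΦ0 hcΦ hαΦ hαF hπB hψB hRΦ hΔ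

end Discharge

end Literature.Probability.FitznerVanDerHofstad2017

end
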